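import Literature.MathematicalPhysics.QuantumFieldTheory.Balaban1983to89.B3Eq14Finite

/-!
# `Balaban1983to89.B3Eq14LamAllOrders` — T. Bałaban, *(Higgs)₂,₃ quantum fields in a finite volume. III.
Renormalization*, Commun. Math. Phys. **88** (1983) 411–445 [Balaban1983Higgs3], (1.4)–(1.5) p. 412 [PDF 2]:
**the auxiliary function `E_k(e′, λ′, Ω, A^{(k)}, φ)` of (1.4) is `C^n` in `λ′` on `[0, δ]` for `C^n` counterterm
data — ALL the one-sided `λ′`-derivatives named by the `β`-sum of the repaired (1.5)
(`B3Eq15OneSidedInteraction.interaction15R`, `B3Sect1Counterterms.pert15R`) exist, each is the right derivative at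
`0⁺` of the previous one, and they are the Taylor coefficients of `E_k(e′, ·)` with an `O(λ′^{n+1})` remainder.**
Successor of the typer's `B3Eq14Finite` (p336498 … p340688), whose §7–§10 settle the orders `β = 1, 2` with closed
formulas (`⟨V⟩`, `⟨∂_{λ′}V⟩ − Var V`); this file settles EXISTENCE and the integral formula to every order (no closed
cumulant formula beyond order 2), in a separate module because the parent file is at the gate's size limit.

statement-level skeleton of published theorems with citation tags; proofs where landed; nothing here is a claim about
the Yang–Mills mass gap

THE ARGUMENT (ours; what the `β`-sum of the printed (1.5) presupposes, for the typed instance `Data14.auxE`).  The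
`λ′`-dependence of the density `exp[…](φ′)` of (1.4) is `exp(−X(λ′))` with the `λ′`-EXPONENT
`X(λ′) = λ′λ(L^kε)Σ_{x∈Ω₁}η^d|φ′(x)|⁴ + ½Σ_{x∈Ω₁}η^dδm²(e′,λ′,x)(L^kε)²|φ′(x)|² + E₁(e′,λ′)` (`lamExponent`,
`density14_eq_exp_neg_lamExponent`); `X′ = V` is §7's `B3Eq14Finite.lamVertex`, `X″ = B3Eq14Finite.lamVertex2`, and
`X^{(i)} = lamVertexN i` for `i ≥ 2` (`iteratedDeriv_lamExponent_succ_succ`).  For data of class `C^n` every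
`X^{(i)}`, `1 ≤ i ≤ n`, is vertex-shaped, hence `≤ A·e^{tΣ_x|φ′(x)|²}` on `[0, δ]` for every `t > 0`
(`exists_iteratedDeriv_lamExponent_le`); the Faà di Bruno estimate `|∂ⁿ_{λ′}e^{−X}| ≤ n!·e^{−X}·max(1, M)ⁿ` (`M` a
common bound of `|X′|, …, |X^{(n)}|`; Mathlib's `norm_iteratedFDeriv_comp_le`) at `t = c/2(j+1)`, with the Gaussian
domination `exp[…] ≤ e^{K₁}e^{−cΣ|φ′|²}` (`B3Eq14Finite.density14_le_explicit`, `c = m₀(L^kε)²η^d/2`) and the kernel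
bound `t(Ω;φ,φ′) ≤ Cκ` (`B3Eq14Finite.kernel14_le`), gives ONE integrable majorant
`Cκ·j!(1+A)ʲe^{K₁}·Π_{x∈Ω}e^{−(c/2)|φ′(x)|²}` of the `j`-th derivative integrand `t·∂ʲ_{λ′}exp[…]` on `[0, δ]`
(`exists_lamIntegrandN_majorant`), so the nested integral `Π_i∫dμ(A′_i)∫dφ′↾_Ω t·exp[…]` — ONE integral on the product
of the fluctuation measure with the fibre Lebesgue measure, `B3Eq14Finite.integral_integrand14_eq_integral_prod` —
may be differentiated `n` times under the integral sign (`hasDerivWithinAt_integral_lamIntegrandN`,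
`iteratedDerivWithin_integral_integrand14_lam`).

WHAT IS PROVED (theorems; three `def`s — `lamExponent`, `lamVertexN`, `lamIntegrandN` —, no `Prop` fact; axioms
standard), under the hypotheses H7 of `B3Eq14Finite` §7 (`μ₀²>0`, `a>0`, `L>1`, `1≤k≤K`, `L^kε≠0`, `λ(L^kε)≥0`,
`0<m₀≤m²`, `m₀ ≤ m²+δm²(e′,λ′,x)` on `[0,δ]×Ω₁`) and data `δm²(e′,·,x)` (`x ∈ Ω₁`), `E₁(e′,·)` of class `C^n`:
* §0 (private toolbox): the vertex-shape bound `exists_vertexShape_le` and dominated differentiation within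
  `[0, δ]` `hasDerivWithinAt_integral_Icc_dominated` (re-proved copies of `B3Eq14Finite`'s private §10 helpers, which
  a separate module cannot see), the Faà di Bruno bound `abs_iteratedDeriv_exp_neg_le`, measurability of
  parameter-iterated derivatives by sequential limits `aestronglyMeasurable_iteratedDeriv_param`, and
  `iteratedDerivWithin_Ici_eq_Icc` (`[0,∞)` and `[0,δ]` agree near `0`);
* §1 `lamExponent`, `density14_eq_exp_neg_lamExponent`, `contDiff_lamExponent`, `contDiff_density14_lam`, `lamVertexN`,
  `hasDerivAt_lamVertexN`, `hasDerivAt_lamExponent` (`X′ = V`), `iteratedDeriv_lamExponent_succ_succ` (`X^{(n)} = V_n`),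
  `exists_iteratedDeriv_lamExponent_le`;
* §2 `abs_iteratedDeriv_density14_le` (`|∂ⁿ_{λ′}exp[…]| ≤ n!·max(1,M)ⁿ·exp[…]`);
* §3 `lamIntegrandN` with `lamIntegrandN_zero/one/two` (orders 0, 1, 2 are the integrands of `B3Eq14Finite` §9/§7/§10:
  `t·exp[…]`, `−V·t·exp[…]`, `(V² − ∂_{λ′}V)·t·exp[…]`), `hasDerivAt_lamIntegrandN`, `aestronglyMeasurable_lamIntegrandN`,
  `exists_lamIntegrandN_majorant`, `integrable_lamIntegrandN`, `hasDerivWithinAt_integral_lamIntegrandN`,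
  `continuousOn_integral_lamIntegrandN`;
* §4 **`iteratedDerivWithin_integral_integrand14_lam`** (`iteratedDerivWithin j (λ′ ↦ exp(−E_k)) [0,δ] λ′ =
  ∫∫ t·∂ʲ_{λ′}exp[…]`, all `j ≤ n`, `λ′ ∈ [0, δ]`), **`contDiffOn_integral_integrand14_lam`**, **`contDiffOn_auxE_lam`**
  (`E_k(e′,·,Ω,A^{(k)},φ)` is `C^n` on `[0, δ]`), `hasDerivWithinAt_iteratedDerivWithin_auxE_Icc`,
  `iteratedDerivWithin_auxE_Ici_eq_Icc`, **`hasDerivWithinAt_iteratedDerivWithin_auxE_Ici`** (the `β`-th quantity of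
  `interaction15R` has right derivative the `(β+1)`-st at `0⁺`, `β < n`);
* §5 **`exists_auxE_taylor_remainder_le`**: for `C^{n+1}` data,
  `|E_k(e′,λ′) − Σ_{β=0}^{n}(β!)⁻¹λ′^β·iteratedDerivWithin β (E_k(e′,·)) [0,∞) 0| ≤ C·λ′^{n+1}` on `[0, δ]` (Mathlib's
  `exists_taylor_mean_remainder_bound`).
HONEST SCOPE: the `λ′`-direction only — nothing about any `e′`-derivative of `E_k` (the charge enters the kernel through
`U(e′𝒜(Γ))` and `Δ^η_{e′𝒜}`; that direction needs moments of the fluctuation measure), hence nothing about the terms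
of (1.5) with `α ≥ 1`; no closed formula for the order-`β` cumulant beyond `B3Eq14Finite` §10; the regularity is that
of the SUPPLIED data `Data14.dm2`, `Data14.E1` (the printed counterterms (1.29)/(1.30) are polynomials in `(e′, λ′)`).

PDF held: `paper:balaban1983-higgs-2-3-quantum-fields-finite-volume` (journal page = PDF page + 410); (1.4)–(1.5) p. 412
[PDF 2] read from the render `run/shared/lean/pub/pub-balaban/b2b-balaban-ref1/pages/` (paper III p002) by typer g4/g24.

CITATION HEADER (lean-in-tree rule).  lit-balaban TYPED SKELETON (HOME `run/shared/lean/pub/lit-balaban/`), rows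
**B3.Eq1.4** / **B3.Eq1.5** (owner r15; decls of record `B3Eq14AuxFunction.Data14.auxE`,
`B3Eq15OneSidedInteraction.interaction15R`); unit `lit-balaban-typer` (literature-prover-lit-balaban-typer-g26-0).
Nothing of any other seat is touched; no row changes head (regularity results about the typed instance).
-/

open _root_.MeasureTheory

namespace Literature.MathematicalPhysics.QuantumFieldTheory.Balaban1983to89.B3Eq14LamAllOrders

open Literature.MathematicalPhysics.QuantumFieldTheory.Balaban1983to89.HiggsLattice
open Literature.MathematicalPhysics.QuantumFieldTheory.Balaban1983to89.HiggsAveraging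
open Literature.MathematicalPhysics.QuantumFieldTheory.Balaban1983to89.HiggsCovariance
open Literature.MathematicalPhysics.QuantumFieldTheory.Balaban1983to89.B3MultiscaleFields
open Literature.MathematicalPhysics.QuantumFieldTheory.Balaban1983to89.HiggsFluctMeasure
open Literature.MathematicalPhysics.QuantumFieldTheory.Balaban1983to89.B1RT
open Literature.MathematicalPhysics.QuantumFieldTheory.Balaban1983to89.B3Eq14AuxFunction
open Literature.MathematicalPhysics.QuantumFieldTheory.Balaban1983to89.B3Eq15OneSidedInteraction
  (sqSum sqSum_nonneg prec_pos)
open Literature.MathematicalPhysics.QuantumFieldTheory.Balaban1983to89.B3Eq14Finite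
open Set Filter Topology
open scoped BigOperators

noncomputable section

variable {P : HiggsLattice.Params} {N : ℕ}

/-! ## 0. Toolbox: vertex-shape bound, dominated differentiation on `[0, δ]`, Faà di Bruno for `e^{−u}`,
measurability of parameter-iterated derivatives, `[0,∞)` vs `[0,δ]` near `0` -/

section Toolbox

variable {k : ℕ} (D : Data14 P N k)

/-- `y ≤ t⁻¹·e^{ty}` (`t > 0`). [folklore] -/
private theorem le_inv_mul_exp {t : ℝ} (ht : 0 < t) (y : ℝ) : y ≤ t⁻¹ * Real.exp (t * y) := by
  have h := Real.add_one_le_exp (t * y)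
  rw [le_inv_mul_iff₀ ht]
  nlinarith [Real.exp_pos (t * y)]

/-- `y² ≤ 2t⁻²·e^{ty}` for `y ≥ 0 < t`. [folklore] -/
private theorem sq_le_inv_sq_mul_exp {t y : ℝ} (ht : 0 < t) (hy : 0 ≤ y) : y ^ 2 ≤ 2 * (t⁻¹) ^ 2 * Real.exp (t * y) := by
  have h := Real.pow_div_factorial_le_exp (t * y) (mul_nonneg ht.le hy) 2
  have hf : ((Nat.factorial 2 : ℕ) : ℝ) = 2 := by norm_num
  rw [hf, div_le_iff₀ (by norm_num : (0 : ℝ) < 2), mul_pow] at h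
  have ht2 : 0 < t ^ 2 := pow_pos ht 2
  calc y ^ 2 = (t⁻¹) ^ 2 * (t ^ 2 * y ^ 2) := by field_simp
    _ ≤ (t⁻¹) ^ 2 * (Real.exp (t * y) * 2) := mul_le_mul_of_nonneg_left h (sq_nonneg _)
    _ = 2 * (t⁻¹) ^ 2 * Real.exp (t * y) := by ring

/-- The quartic of `Ω₁` is at most `η^d(Σ_x|φ′(x)|²)²`. [folklore] -/
private theorem quartic_le_sqSum_sq (φ' : HiggsLattice.ScalarField P 0 N) :
    ∑ x ∈ D.Ω₁, P.mesh 0 ^ P.d * ‖φ' x‖ ^ 4 ≤ P.mesh 0 ^ P.d * (sqSum φ') ^ 2 := by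
  have hη : 0 < P.mesh 0 ^ P.d := pow_pos (P.mesh_pos 0) _
  rw [← Finset.mul_sum]
  refine mul_le_mul_of_nonneg_left ?_ hη.le
  have h1 : ∑ x ∈ D.Ω₁, ‖φ' x‖ ^ 4 ≤ ∑ x ∈ D.Ω₁, sqSum φ' * ‖φ' x‖ ^ 2 := by
    refine Finset.sum_le_sum fun x _ => ?_
    have hx := B3Eq15OneSidedInteraction.sq_le_sqSum φ' x
    nlinarith [sq_nonneg ‖φ' x‖]
  have h2 : ∑ x ∈ D.Ω₁, sqSum φ' * ‖φ' x‖ ^ 2 ≤ sqSum φ' * sqSum φ' := by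
    rw [← Finset.mul_sum]
    refine mul_le_mul_of_nonneg_left ?_ (sqSum_nonneg φ')
    unfold sqSum
    exact Finset.sum_le_sum_of_subset_of_nonneg (Finset.subset_univ _) fun x _ _ => sq_nonneg _
  nlinarith [h1, h2]

/-- **The VERTEX-SHAPE BOUND** (copy of `B3Eq14Finite`'s private §10 helper): a function
`q·Σ_{Ω₁}η^d|φ′|⁴ + ½Σ_{Ω₁}η^d g(x,s)(L^kε)²|φ′|² + h(s)` with `0 ≤ q` and coefficients `g(x,·)`, `h` continuous on
`[0, δ]` is `≤ A·exp(tΣ_x|φ′(x)|²)` there, for every `t > 0`. [folklore] -/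
private theorem exists_vertexShape_le {t : ℝ} (ht : 0 < t) {δ q : ℝ} (hq : 0 ≤ q)
    {g : HiggsLattice.Site P 0 → ℝ → ℝ} {h : ℝ → ℝ}
    (hg : ∀ x ∈ D.Ω₁, ContinuousOn (g x) (Set.Icc 0 δ)) (hh : ContinuousOn h (Set.Icc 0 δ)) :
    ∃ A : ℝ, 0 ≤ A ∧ ∀ s ∈ Set.Icc (0 : ℝ) δ, ∀ φ' : HiggsLattice.ScalarField P 0 N,
      |q * ∑ x ∈ D.Ω₁, P.mesh 0 ^ P.d * ‖φ' x‖ ^ 4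
        + (1 / 2 : ℝ) * ∑ x ∈ D.Ω₁, P.mesh 0 ^ P.d * g x s * D.ell ^ 2 * ‖φ' x‖ ^ 2 + h s|
        ≤ A * Real.exp (t * sqSum φ') := by
  have hη : 0 < P.mesh 0 ^ P.d := pow_pos (P.mesh_pos 0) _
  have hℓ2 : 0 ≤ D.ell ^ 2 := sq_nonneg _
  have hbdx : ∀ x : HiggsLattice.Site P 0, ∃ B : ℝ, 0 ≤ B ∧ (x ∈ D.Ω₁ → ∀ s ∈ Set.Icc (0 : ℝ) δ, |g x s| ≤ B) := by
    intro x
    by_cases hx : x ∈ D.Ω₁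
    · obtain ⟨C, hC⟩ := isCompact_Icc.exists_bound_of_continuousOn (hg x hx)
      exact ⟨max C 0, le_max_right _ _, fun _ s hs =>
        ((Real.norm_eq_abs _).symm.le.trans (hC s hs)).trans (le_max_left _ _)⟩
    · exact ⟨0, le_rfl, fun h => absurd h hx⟩
  choose B hB0 hB using hbdx
  obtain ⟨B₁, hB₁0, hB₁⟩ : ∃ B₁ : ℝ, 0 ≤ B₁ ∧ ∀ s ∈ Set.Icc (0 : ℝ) δ, |h s| ≤ B₁ := by
    obtain ⟨C, hC⟩ := isCompact_Icc.exists_bound_of_continuousOn hh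
    exact ⟨max C 0, le_max_right _ _, fun s hs => ((Real.norm_eq_abs _).symm.le.trans (hC s hs)).trans (le_max_left _ _)⟩
  set A₀ : ℝ := q * P.mesh 0 ^ P.d * (2 * (t⁻¹) ^ 2)
      + (1 / 2 : ℝ) * (P.mesh 0 ^ P.d * D.ell ^ 2 * ∑ x ∈ D.Ω₁, B x) * t⁻¹ + B₁ with hA₀
  have hA₀0 : 0 ≤ A₀ := by
    have : 0 ≤ ∑ x ∈ D.Ω₁, B x := Finset.sum_nonneg fun x _ => hB0 x
    positivity
  refine ⟨A₀, hA₀0, fun s hs φ' => ?_⟩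
  have hS0 := sqSum_nonneg φ'
  have hex1 : 1 ≤ Real.exp (t * sqSum φ') := Real.one_le_exp (mul_nonneg ht.le hS0)
  have hq4 : |q * ∑ x ∈ D.Ω₁, P.mesh 0 ^ P.d * ‖φ' x‖ ^ 4|
      ≤ q * P.mesh 0 ^ P.d * (2 * (t⁻¹) ^ 2) * Real.exp (t * sqSum φ') := by
    rw [abs_of_nonneg (mul_nonneg hq (Finset.sum_nonneg fun x _ => by positivity))]
    have h1 := quartic_le_sqSum_sq D φ'
    have h2 := sq_le_inv_sq_mul_exp ht hS0
    calc q * ∑ x ∈ D.Ω₁, P.mesh 0 ^ P.d * ‖φ' x‖ ^ 4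
        ≤ q * (P.mesh 0 ^ P.d * (sqSum φ') ^ 2) := mul_le_mul_of_nonneg_left h1 hq
      _ ≤ q * (P.mesh 0 ^ P.d * (2 * (t⁻¹) ^ 2 * Real.exp (t * sqSum φ'))) :=
          mul_le_mul_of_nonneg_left (mul_le_mul_of_nonneg_left h2 hη.le) hq
      _ = q * P.mesh 0 ^ P.d * (2 * (t⁻¹) ^ 2) * Real.exp (t * sqSum φ') := by ring
  have hmass2 : |(1 / 2 : ℝ) * ∑ x ∈ D.Ω₁, P.mesh 0 ^ P.d * g x s * D.ell ^ 2 * ‖φ' x‖ ^ 2|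
      ≤ (1 / 2 : ℝ) * (P.mesh 0 ^ P.d * D.ell ^ 2 * ∑ x ∈ D.Ω₁, B x) * t⁻¹ * Real.exp (t * sqSum φ') := by
    rw [abs_mul, abs_of_pos (by norm_num : (0 : ℝ) < 1 / 2)]
    have h1 : |∑ x ∈ D.Ω₁, P.mesh 0 ^ P.d * g x s * D.ell ^ 2 * ‖φ' x‖ ^ 2|
        ≤ ∑ x ∈ D.Ω₁, P.mesh 0 ^ P.d * B x * D.ell ^ 2 * sqSum φ' := by
      refine (Finset.abs_sum_le_sum_abs _ _).trans (Finset.sum_le_sum fun x hx => ?_)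
      rw [abs_mul, abs_mul, abs_mul, abs_of_pos hη, abs_of_nonneg hℓ2, abs_of_nonneg (sq_nonneg ‖φ' x‖)]
      have hb := hB x hx s hs
      have hr := B3Eq15OneSidedInteraction.sq_le_sqSum φ' x
      have := mul_le_mul hb hr (sq_nonneg _) (hB0 x)
      calc P.mesh 0 ^ P.d * |g x s| * D.ell ^ 2 * ‖φ' x‖ ^ 2
          = P.mesh 0 ^ P.d * D.ell ^ 2 * (|g x s| * ‖φ' x‖ ^ 2) := by ring
        _ ≤ P.mesh 0 ^ P.d * D.ell ^ 2 * (B x * sqSum φ') :=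
            mul_le_mul_of_nonneg_left this (mul_nonneg hη.le hℓ2)
        _ = P.mesh 0 ^ P.d * B x * D.ell ^ 2 * sqSum φ' := by ring
    have h2 : ∑ x ∈ D.Ω₁, P.mesh 0 ^ P.d * B x * D.ell ^ 2 * sqSum φ'
        = (P.mesh 0 ^ P.d * D.ell ^ 2 * ∑ x ∈ D.Ω₁, B x) * sqSum φ' := by
      rw [Finset.mul_sum, Finset.sum_mul]
      refine Finset.sum_congr rfl fun x _ => ?_
      ring
    have h3 := le_inv_mul_exp ht (sqSum φ')
    have hBs : 0 ≤ P.mesh 0 ^ P.d * D.ell ^ 2 * ∑ x ∈ D.Ω₁, B x :=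
      mul_nonneg (mul_nonneg hη.le hℓ2) (Finset.sum_nonneg fun x _ => hB0 x)
    rw [h2] at h1
    calc (1 / 2 : ℝ) * |∑ x ∈ D.Ω₁, P.mesh 0 ^ P.d * g x s * D.ell ^ 2 * ‖φ' x‖ ^ 2|
        ≤ (1 / 2 : ℝ) * ((P.mesh 0 ^ P.d * D.ell ^ 2 * ∑ x ∈ D.Ω₁, B x) * sqSum φ') :=
          mul_le_mul_of_nonneg_left h1 (by norm_num)
      _ ≤ (1 / 2 : ℝ) * ((P.mesh 0 ^ P.d * D.ell ^ 2 * ∑ x ∈ D.Ω₁, B x) * (t⁻¹ * Real.exp (t * sqSum φ'))) :=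
          mul_le_mul_of_nonneg_left (mul_le_mul_of_nonneg_left h3 hBs) (by norm_num)
      _ = (1 / 2 : ℝ) * (P.mesh 0 ^ P.d * D.ell ^ 2 * ∑ x ∈ D.Ω₁, B x) * t⁻¹ * Real.exp (t * sqSum φ') := by ring
  have hE : |h s| ≤ B₁ * Real.exp (t * sqSum φ') := (hB₁ s hs).trans (le_mul_of_one_le_right hB₁0 hex1)
  refine (abs_add_le _ _).trans ((add_le_add ((abs_add_le _ _).trans (add_le_add hq4 hmass2)) hE).trans ?_)
  rw [hA₀]
  ring_nf
  rfl

/-- **DOMINATED DIFFERENTIATION of a parameter integral at a point of `[0, δ]`, within `[0, δ]`** (copy of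
`B3Eq14Finite`'s private §10 helper): `F(·, z)` differentiable everywhere with derivative `F′(·, z)`, `|F′(s, z)| ≤
bound(z)` for `s ∈ [0, δ]` with `bound` integrable, `F(s, ·)` measurable and integrable on `[0, δ]`; the mean
value theorem supplies the majorant of the difference quotients on both sides of the base point. [folklore] -/
private theorem hasDerivWithinAt_integral_Icc_dominated {Z : Type*} [MeasurableSpace Z] {ν : Measure Z}
    {F F' : ℝ → Z → ℝ} {bound : Z → ℝ} {δ s₀ : ℝ} (hs₀ : s₀ ∈ Set.Icc (0 : ℝ) δ)
    (hF_meas : ∀ s, AEStronglyMeasurable (F s) ν) (hF_int : ∀ s ∈ Set.Icc (0 : ℝ) δ, Integrable (F s) ν)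
    (hderiv : ∀ z s, HasDerivAt (fun s => F s z) (F' s z) s)
    (hbound : ∀ s ∈ Set.Icc (0 : ℝ) δ, ∀ z, |F' s z| ≤ bound z) (hbound_int : Integrable bound ν) :
    HasDerivWithinAt (fun s => ∫ z, F s z ∂ν) (∫ z, F' s₀ z ∂ν) (Set.Icc 0 δ) s₀ := by
  rw [hasDerivWithinAt_iff_tendsto_slope]
  set G : ℝ → Z → ℝ := fun s z => slope (fun s => F s z) s₀ s with hG
  have hev : ∀ᶠ s in 𝓝[Set.Icc (0 : ℝ) δ \ {s₀}] s₀, s ∈ Set.Icc (0 : ℝ) δ \ {s₀} := self_mem_nhdsWithin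
  have key : ∀ s ∈ Set.Icc (0 : ℝ) δ \ {s₀},
      slope (fun s => ∫ z, F s z ∂ν) s₀ s = ∫ z, G s z ∂ν := by
    intro s hs
    rw [slope_def_field, ← integral_sub (hF_int s hs.1) (hF_int s₀ hs₀), ← integral_div]
    refine integral_congr_ae (Filter.Eventually.of_forall fun z => ?_)
    simp only [hG, slope_def_field]
  have hmeas : ∀ᶠ s in 𝓝[Set.Icc (0 : ℝ) δ \ {s₀}] s₀, AEStronglyMeasurable (G s) ν := by
    refine Filter.Eventually.of_forall fun s => ?_
    have h : AEStronglyMeasurable (fun z => (s - s₀)⁻¹ * (F s z - F s₀ z)) ν :=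
      ((hF_meas s).sub (hF_meas s₀)).const_mul _
    refine h.congr (Filter.Eventually.of_forall fun z => ?_)
    simp only [hG, slope_def_field, div_eq_inv_mul]
  have hbd : ∀ᶠ s in 𝓝[Set.Icc (0 : ℝ) δ \ {s₀}] s₀, ∀ᵐ z ∂ν, ‖G s z‖ ≤ bound z := by
    filter_upwards [hev] with s hs
    refine Filter.Eventually.of_forall fun z => ?_
    rcases lt_or_gt_of_ne (show s ≠ s₀ from hs.2) with hlt | hgt
    · obtain ⟨c', hc', hc'eq⟩ := exists_hasDerivAt_eq_slope (fun s => F s z) (fun s => F' s z) hlt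
        (HasDerivAt.continuousOn fun s _ => hderiv z s) (fun s _ => hderiv z s)
      have hcI : c' ∈ Set.Icc (0 : ℝ) δ := ⟨hs.1.1.trans hc'.1.le, (hc'.2.trans_le hs₀.2).le⟩
      have eG : G s z = F' c' z := by
        rw [hc'eq, hG]
        simp only [slope_def_field]
        rw [show F s₀ z - F s z = -(F s z - F s₀ z) by ring, show s₀ - s = -(s - s₀) by ring, neg_div_neg_eq]
      rw [Real.norm_eq_abs, eG]
      exact hbound c' hcI z
    · obtain ⟨c', hc', hc'eq⟩ := exists_hasDerivAt_eq_slope (fun s => F s z) (fun s => F' s z) hgt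
        (HasDerivAt.continuousOn fun s _ => hderiv z s) (fun s _ => hderiv z s)
      have hcI : c' ∈ Set.Icc (0 : ℝ) δ := ⟨hs₀.1.trans hc'.1.le, (hc'.2.trans_le hs.1.2).le⟩
      have eG : G s z = F' c' z := by
        rw [hc'eq, hG]
        simp only [slope_def_field]
      rw [Real.norm_eq_abs, eG]
      exact hbound c' hcI z
  have hlim : ∀ᵐ z ∂ν, Filter.Tendsto (fun s => G s z) (𝓝[Set.Icc (0 : ℝ) δ \ {s₀}] s₀) (𝓝 (F' s₀ z)) := by
    refine Filter.Eventually.of_forall fun z => ?_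
    exact (hderiv z s₀).tendsto_slope.mono_left (nhdsWithin_mono _ fun x hx => hx.2)
  exact (tendsto_integral_filter_of_dominated_convergence bound hmeas hbd hbound_int hlim).congr'
    (by filter_upwards [hev] with s hs using (key s hs).symm)

/-- `iteratedDeriv n exp = exp`. [folklore] -/
private theorem iteratedDeriv_real_exp (n : ℕ) : iteratedDeriv n Real.exp = Real.exp := by
  rw [iteratedDeriv_eq_iterate, Real.iter_deriv_exp]

/-- **Faà di Bruno bound for `e^{−u}`**: if `|u^{(i)}(s)| ≤ M` for `1 ≤ i ≤ n` (`u` of class `C^n`) then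
`|∂ⁿe^{−u}(s)| ≤ n!·e^{−u(s)}·max(1, M)ⁿ` (Mathlib's `norm_iteratedFDeriv_comp_le`). [folklore] -/
private theorem abs_iteratedDeriv_exp_neg_le {u : ℝ → ℝ} {n : ℕ} (hu : ContDiff ℝ n u) (s : ℝ) {M : ℝ}
    (hM : ∀ i, 1 ≤ i → i ≤ n → |iteratedDeriv i u s| ≤ M) :
    |iteratedDeriv n (fun s => Real.exp (-u s)) s|
      ≤ (Nat.factorial n : ℝ) * Real.exp (-u s) * (max 1 M) ^ n := by
  have hf : ContDiff ℝ n (fun s => -u s) := hu.neg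
  have h := norm_iteratedFDeriv_comp_le (g := Real.exp) (f := fun s => -u s) (n := n) (N := n)
    Real.contDiff_exp hf le_rfl s (C := Real.exp (-u s)) (D := max 1 M) ?_ ?_
  · rw [norm_iteratedFDeriv_eq_norm_iteratedDeriv, Real.norm_eq_abs] at h
    exact h
  · intro i _
    rw [norm_iteratedFDeriv_eq_norm_iteratedDeriv, iteratedDeriv_real_exp, Real.norm_eq_abs,
      abs_of_pos (Real.exp_pos _)]
  · intro i hi1 hin
    rw [norm_iteratedFDeriv_eq_norm_iteratedDeriv, Real.norm_eq_abs]
    have e : iteratedDeriv i (fun s => -u s) s = -iteratedDeriv i u s := iteratedDeriv_fun_neg i u s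
    rw [e, abs_neg]
    calc |iteratedDeriv i u s| ≤ M := hM i hi1 hin
      _ ≤ max 1 M := le_max_right _ _
      _ = (max 1 M) ^ 1 := (pow_one _).symm
      _ ≤ (max 1 M) ^ i := pow_le_pow_right₀ (le_max_left _ _) hi1

/-- `|∂ⁿ(c·e^{−u})(s)| ≤ n!·max(1, M)ⁿ·(c·e^{−u(s)})` for `c ≥ 0`. [folklore] -/
private theorem abs_iteratedDeriv_const_mul_exp_neg_le {u : ℝ → ℝ} {n : ℕ} (hu : ContDiff ℝ n u) {c : ℝ}
    (hc : 0 ≤ c) (s : ℝ) {M : ℝ} (hM : ∀ i, 1 ≤ i → i ≤ n → |iteratedDeriv i u s| ≤ M) :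
    |iteratedDeriv n (fun s => c * Real.exp (-u s)) s|
      ≤ (Nat.factorial n : ℝ) * (max 1 M) ^ n * (c * Real.exp (-u s)) := by
  rw [iteratedDeriv_const_mul_field, abs_mul, abs_of_nonneg hc]
  have h := abs_iteratedDeriv_exp_neg_le hu s hM
  calc c * |iteratedDeriv n (fun s => Real.exp (-u s)) s|
      ≤ c * ((Nat.factorial n : ℝ) * Real.exp (-u s) * (max 1 M) ^ n) := mul_le_mul_of_nonneg_left h hc
    _ = (Nat.factorial n : ℝ) * (max 1 M) ^ n * (c * Real.exp (-u s)) := by ring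

/-- **Measurability of a parameter-iterated derivative `z ↦ ∂ʲ_s G(s, z)`** from that of `G(s, ·)` (`G(·, z)` of
class `C^n`, `j ≤ n`): the `(j+1)`-st is a sequential limit of difference quotients of the `j`-th. [folklore] -/
private theorem aestronglyMeasurable_iteratedDeriv_param {Z : Type*} [MeasurableSpace Z] {ν : Measure Z}
    {G : ℝ → Z → ℝ} {n : ℕ} (hG : ∀ z, ContDiff ℝ n (fun s => G s z))
    (hmeas : ∀ s, AEStronglyMeasurable (G s) ν) :
    ∀ j, j ≤ n → ∀ s, AEStronglyMeasurable (fun z => iteratedDeriv j (fun s => G s z) s) ν := by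
  intro j
  induction j with
  | zero => intro _ s; simpa only [iteratedDeriv_zero] using hmeas s
  | succ j ih =>
    intro hj s
    have hj' : j ≤ n := (Nat.le_succ j).trans hj
    have hlt : (j : WithTop ℕ∞) < n := by exact_mod_cast Nat.lt_of_succ_le hj
    set u : ℕ → ℝ := fun m => s + 1 / ((m : ℝ) + 1) with hu
    have hu_tend : Tendsto u atTop (𝓝[≠] s) := by
      refine tendsto_nhdsWithin_of_tendsto_nhds_of_eventually_within _ ?_ (Eventually.of_forall fun m => ?_)
      · have h : Tendsto (fun m : ℕ => s + 1 / ((m : ℝ) + 1)) atTop (𝓝 (s + 0)) :=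
          tendsto_const_nhds.add tendsto_one_div_add_atTop_nhds_zero_nat
        rw [add_zero] at h
        exact h
      · simp only [hu, Set.mem_compl_iff, Set.mem_singleton_iff, add_eq_left, one_div, inv_eq_zero]
        exact Nat.cast_add_one_ne_zero m
    have hlim : ∀ z, Tendsto (fun m => slope (fun s => iteratedDeriv j (fun s => G s z) s) s (u m)) atTop
        (𝓝 (iteratedDeriv (j + 1) (fun s => G s z) s)) := by
      intro z
      have hd : DifferentiableAt ℝ (iteratedDeriv j (fun s => G s z)) s :=
        ((hG z).differentiable_iteratedDeriv j hlt).differentiableAt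
      rw [iteratedDeriv_succ]
      exact hd.hasDerivAt.tendsto_slope.comp hu_tend
    refine aestronglyMeasurable_of_tendsto_ae atTop (fun m => ?_) (Eventually.of_forall hlim)
    have e : (fun z => slope (fun s => iteratedDeriv j (fun s => G s z) s) s (u m))
        = fun z => (u m - s)⁻¹ * (iteratedDeriv j (fun s => G s z) (u m) - iteratedDeriv j (fun s => G s z) s) := by
      funext z; rw [slope_def_field, div_eq_inv_mul]
    rw [e]
    exact ((ih hj' (u m)).sub (ih hj' s)).const_mul _

/-- Near every `u < δ` the sets `[0, ∞)` and `[0, δ]` coincide, so iterated derivatives within them agree at `u`.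
[folklore] -/
private theorem iteratedDerivWithin_Ici_eq_Icc {f : ℝ → ℝ} {δ u : ℝ} (hu : u < δ) (n : ℕ) :
    iteratedDerivWithin n f (Set.Ici 0) u = iteratedDerivWithin n f (Set.Icc 0 δ) u := by
  have h : Set.Ici (0 : ℝ) =ᶠ[𝓝 u] Set.Icc 0 δ := by
    filter_upwards [Iio_mem_nhds hu] with x hx
    simp only [eq_iff_iff]
    exact ⟨fun h => ⟨h, (Set.mem_Iio.1 hx).le⟩, fun h => h.1⟩
  rw [iteratedDerivWithin_eq_iteratedFDerivWithin, iteratedDerivWithin_eq_iteratedFDerivWithin,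
    iteratedFDerivWithin_congr_set h]

end Toolbox

section LamAllOrders

variable {k : ℕ} (D : Data14 P N k)

/-! ## 1. The `λ′`-exponent `X` and its derivatives (the higher vertices) -/

/-- The `λ′`-EXPONENT of the density of (1.4): `X(e′,φ′)(s) = s·λ(L^kε)Σ_{x∈Ω₁}η^d|φ′(x)|⁴ +
½Σ_{x∈Ω₁}η^dδm²(e′,s,x)(L^kε)²|φ′(x)|² + E₁(e′,s)` — minus the `λ′`-dependent part of the exponent, so that
`exp[…](φ′) = exp(−½⟨φ′,(−Δ^η_{𝒜,Ω} + m²(L^kε)²)φ′⟩)·exp(−X(λ′))` (`density14_eq_exp_neg_lamExponent`). (ours)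
[cite: Balaban1983Higgs3, (1.4) p.412] -/
noncomputable def lamExponent (e' : ℝ) (φ' : HiggsLattice.ScalarField P 0 N) (s : ℝ) : ℝ :=
  s * D.lamRun * ∑ x ∈ D.Ω₁, P.mesh 0 ^ P.d * ‖φ' x‖ ^ 4
    + (1 / 2 : ℝ) * ∑ x ∈ D.Ω₁, P.mesh 0 ^ P.d * D.dm2 e' s x * D.ell ^ 2 * ‖φ' x‖ ^ 2
    + D.E1 e' s

/-- Unfolding of `lamExponent`. [cite: Balaban1983Higgs3, (1.4) p.412] -/
theorem lamExponent_def (e' : ℝ) (φ' : HiggsLattice.ScalarField P 0 N) (s : ℝ) :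
    lamExponent D e' φ' s = s * D.lamRun * ∑ x ∈ D.Ω₁, P.mesh 0 ^ P.d * ‖φ' x‖ ^ 4
      + (1 / 2 : ℝ) * ∑ x ∈ D.Ω₁, P.mesh 0 ^ P.d * D.dm2 e' s x * D.ell ^ 2 * ‖φ' x‖ ^ 2
      + D.E1 e' s := rfl

/-- **`exp[…](φ′) = exp(−½⟨φ′,(−Δ^η_{e′g_kA′+A^{(k)},Ω} + m²(L^kε)²)φ′⟩)·exp(−X(λ′))`**: the `λ′`-dependence of the
density of (1.4) is carried by the exponent `X` alone. [cite: Balaban1983Higgs3, (1.4) p.412] -/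
theorem density14_eq_exp_neg_lamExponent (Ak : HiggsLattice.VecField P 0) (e' s : ℝ)
    (A' : (j : Fin k) → HiggsLattice.VecField P j) (φ' : HiggsLattice.ScalarField P 0 N) :
    D.density14 Ak e' s A' φ'
      = Real.exp (-(1 / 2 : ℝ) * siteInner φ' (D.scalarOp Ak e' A' φ')) * Real.exp (-lamExponent D e' φ' s) := by
  rw [Data14.density14_eq, lamExponent_def, ← Real.exp_add]
  congr 1
  ring

/-- **`X` is `C^n` in `λ′` for `C^n` data** `δm²(e′,·,x)` (`x ∈ Ω₁`), `E₁(e′,·)`. [cite: Balaban1983Higgs3, (1.4) p.412] -/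
theorem contDiff_lamExponent {n : ℕ} {e' : ℝ} (hdm2 : ∀ x ∈ D.Ω₁, ContDiff ℝ n (fun s => D.dm2 e' s x))
    (hE1 : ContDiff ℝ n (fun s => D.E1 e' s)) (φ' : HiggsLattice.ScalarField P 0 N) :
    ContDiff ℝ n (lamExponent D e' φ') := by
  have h : ContDiff ℝ n (fun s : ℝ => s * D.lamRun * ∑ x ∈ D.Ω₁, P.mesh 0 ^ P.d * ‖φ' x‖ ^ 4
      + (1 / 2 : ℝ) * ∑ x ∈ D.Ω₁, P.mesh 0 ^ P.d * D.dm2 e' s x * D.ell ^ 2 * ‖φ' x‖ ^ 2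
      + D.E1 e' s) := by
    refine (((contDiff_id.mul contDiff_const).mul contDiff_const).add
      (contDiff_const.mul (ContDiff.sum fun x hx => ?_))).add hE1
    exact ((contDiff_const.mul (hdm2 x hx)).mul contDiff_const).mul contDiff_const
  have e : lamExponent D e' φ' = fun s : ℝ => s * D.lamRun * ∑ x ∈ D.Ω₁, P.mesh 0 ^ P.d * ‖φ' x‖ ^ 4
      + (1 / 2 : ℝ) * ∑ x ∈ D.Ω₁, P.mesh 0 ^ P.d * D.dm2 e' s x * D.ell ^ 2 * ‖φ' x‖ ^ 2
      + D.E1 e' s := rfl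
  rw [e]
  exact h

/-- **The density of (1.4) is `C^n` in `λ′` for `C^n` data**, for all fields. [cite: Balaban1983Higgs3, (1.4) p.412] -/
theorem contDiff_density14_lam {n : ℕ} {e' : ℝ} (hdm2 : ∀ x ∈ D.Ω₁, ContDiff ℝ n (fun s => D.dm2 e' s x))
    (hE1 : ContDiff ℝ n (fun s => D.E1 e' s)) (Ak : HiggsLattice.VecField P 0)
    (A' : (j : Fin k) → HiggsLattice.VecField P j) (φ' : HiggsLattice.ScalarField P 0 N) :
    ContDiff ℝ n (fun s => D.density14 Ak e' s A' φ') := by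
  have e : (fun s => D.density14 Ak e' s A' φ')
      = fun s => Real.exp (-(1 / 2 : ℝ) * siteInner φ' (D.scalarOp Ak e' A' φ'))
          * Real.exp (-lamExponent D e' φ' s) :=
    funext fun s => density14_eq_exp_neg_lamExponent D Ak e' s A' φ'
  rw [e]
  exact contDiff_const.mul (Real.contDiff_exp.comp (contDiff_lamExponent D hdm2 hE1 φ').neg)

/-- The HIGHER `λ′`-VERTICES: `V_n(e′,s,φ′) = ½Σ_{x∈Ω₁}η^d(∂ⁿ_{λ′}δm²)(e′,s,x)(L^kε)²|φ′(x)|² + (∂ⁿ_{λ′}E₁)(e′,s)` —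
the mass-counterterm vertex (1.7) and the vacuum counterterm differentiated `n` times in `λ′` (the quartic (1.6) is
linear in `λ′` and does not contribute for `n ≥ 2`); `V = λ(L^kε)Σ_{Ω₁}η^d|φ′|⁴ + V_1`, `lamVertex2 = V_2`, and
`X^{(n)} = V_n` for `n ≥ 2`. (ours) [cite: Balaban1983Higgs3, (1.4)–(1.7) pp.412–413] -/
noncomputable def lamVertexN (n : ℕ) (e' s : ℝ) (φ' : HiggsLattice.ScalarField P 0 N) : ℝ :=
  (1 / 2 : ℝ) * ∑ x ∈ D.Ω₁, P.mesh 0 ^ P.d * iteratedDeriv n (fun u => D.dm2 e' u x) s * D.ell ^ 2 * ‖φ' x‖ ^ 2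
    + iteratedDeriv n (fun u => D.E1 e' u) s

/-- Unfolding of `lamVertexN`. [cite: Balaban1983Higgs3, (1.4)–(1.7) pp.412–413] -/
theorem lamVertexN_def (n : ℕ) (e' s : ℝ) (φ' : HiggsLattice.ScalarField P 0 N) :
    lamVertexN D n e' s φ' = (1 / 2 : ℝ) * ∑ x ∈ D.Ω₁, P.mesh 0 ^ P.d
        * iteratedDeriv n (fun u => D.dm2 e' u x) s * D.ell ^ 2 * ‖φ' x‖ ^ 2
      + iteratedDeriv n (fun u => D.E1 e' u) s := rfl

/-- `V = λ(L^kε)Σ_{x∈Ω₁}η^d|φ′(x)|⁴ + V_1`. [cite: Balaban1983Higgs3, (1.4)–(1.7) pp.412–413] -/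
theorem lamVertex_eq_quartic_add_lamVertexN_one (e' s : ℝ) (φ' : HiggsLattice.ScalarField P 0 N) :
    lamVertex D e' s φ' = D.lamRun * ∑ x ∈ D.Ω₁, P.mesh 0 ^ P.d * ‖φ' x‖ ^ 4 + lamVertexN D 1 e' s φ' := by
  rw [lamVertex_def, lamVertexN_def]
  simp only [iteratedDeriv_one]
  ring

/-- `lamVertex2 = V_2`. [cite: Balaban1983Higgs3, (1.4)–(1.7) pp.412–413] -/
theorem lamVertex2_eq_lamVertexN_two (e' s : ℝ) (φ' : HiggsLattice.ScalarField P 0 N) :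
    lamVertex2 D e' s φ' = lamVertexN D 2 e' s φ' := rfl

/-- **`∂_{λ′}V_n = V_{n+1}`** for data of class `C^m`, `n < m`. [cite: Balaban1983Higgs3, (1.4)–(1.7) pp.412–413] -/
theorem hasDerivAt_lamVertexN {n m : ℕ} {e' : ℝ} (hdm2 : ∀ x ∈ D.Ω₁, ContDiff ℝ m (fun s => D.dm2 e' s x))
    (hE1 : ContDiff ℝ m (fun s => D.E1 e' s)) (hn : n < m) (φ' : HiggsLattice.ScalarField P 0 N) (s : ℝ) :
    HasDerivAt (fun u => lamVertexN D n e' u φ') (lamVertexN D (n + 1) e' s φ') s := by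
  have hlt : (n : WithTop ℕ∞) < m := by exact_mod_cast hn
  have hd : ∀ {f : ℝ → ℝ}, ContDiff ℝ m f → HasDerivAt (iteratedDeriv n f) (iteratedDeriv (n + 1) f s) s := by
    intro f hf
    rw [iteratedDeriv_succ]
    exact ((hf.differentiable_iteratedDeriv n hlt) s).hasDerivAt
  have h3 : HasDerivAt (fun u : ℝ => ∑ x ∈ D.Ω₁, P.mesh 0 ^ P.d
        * iteratedDeriv n (fun v => D.dm2 e' v x) u * D.ell ^ 2 * ‖φ' x‖ ^ 2)
      (∑ x ∈ D.Ω₁, P.mesh 0 ^ P.d * iteratedDeriv (n + 1) (fun v => D.dm2 e' v x) s * D.ell ^ 2 * ‖φ' x‖ ^ 2) s := by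
    refine HasDerivAt.fun_sum (u := D.Ω₁)
      (A := fun x u => P.mesh 0 ^ P.d * iteratedDeriv n (fun v => D.dm2 e' v x) u * D.ell ^ 2 * ‖φ' x‖ ^ 2)
      (A' := fun x => P.mesh 0 ^ P.d * iteratedDeriv (n + 1) (fun v => D.dm2 e' v x) s * D.ell ^ 2 * ‖φ' x‖ ^ 2)
      fun x hx => ?_
    exact (((hd (hdm2 x hx)).const_mul (P.mesh 0 ^ P.d)).mul_const (D.ell ^ 2)).mul_const (‖φ' x‖ ^ 2)
  have h : HasDerivAt (fun u : ℝ => (1 / 2 : ℝ) * ∑ x ∈ D.Ω₁, P.mesh 0 ^ P.d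
        * iteratedDeriv n (fun v => D.dm2 e' v x) u * D.ell ^ 2 * ‖φ' x‖ ^ 2
      + iteratedDeriv n (fun v => D.E1 e' v) u)
      ((1 / 2 : ℝ) * ∑ x ∈ D.Ω₁, P.mesh 0 ^ P.d * iteratedDeriv (n + 1) (fun v => D.dm2 e' v x) s * D.ell ^ 2 * ‖φ' x‖ ^ 2
      + iteratedDeriv (n + 1) (fun v => D.E1 e' v) s) s :=
    (h3.const_mul (1 / 2 : ℝ)).add (hd hE1)
  have e : (fun u => lamVertexN D n e' u φ') = fun u : ℝ => (1 / 2 : ℝ) * ∑ x ∈ D.Ω₁, P.mesh 0 ^ P.d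
        * iteratedDeriv n (fun v => D.dm2 e' v x) u * D.ell ^ 2 * ‖φ' x‖ ^ 2
      + iteratedDeriv n (fun v => D.E1 e' v) u := by
    funext u; rw [lamVertexN_def]
  rw [e]
  refine h.congr_deriv ?_
  rw [lamVertexN_def]

/-- **`X′ = V`**: the exponent is differentiable in `λ′` with derivative the `λ′`-vertex of §7 (data `C^m`, `m ≥ 1`).
[cite: Balaban1983Higgs3, (1.4)–(1.7) pp.412–413] -/
theorem hasDerivAt_lamExponent {m : ℕ} {e' : ℝ} (hdm2 : ∀ x ∈ D.Ω₁, ContDiff ℝ m (fun s => D.dm2 e' s x))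
    (hE1 : ContDiff ℝ m (fun s => D.E1 e' s)) (hm : 1 ≤ m) (φ' : HiggsLattice.ScalarField P 0 N) (s : ℝ) :
    HasDerivAt (lamExponent D e' φ') (lamVertex D e' s φ') s := by
  have hm0 : (m : WithTop ℕ∞) ≠ 0 := by exact_mod_cast Nat.one_le_iff_ne_zero.mp hm
  have hdm2d : ∀ x ∈ D.Ω₁, DifferentiableAt ℝ (fun u => D.dm2 e' u x) s :=
    fun x hx => ((hdm2 x hx).differentiable hm0).differentiableAt
  have hE1d : DifferentiableAt ℝ (fun u => D.E1 e' u) s := (hE1.differentiable hm0).differentiableAt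
  have h2 : HasDerivAt (fun u : ℝ => u * D.lamRun * ∑ x ∈ D.Ω₁, P.mesh 0 ^ P.d * ‖φ' x‖ ^ 4)
      (1 * D.lamRun * ∑ x ∈ D.Ω₁, P.mesh 0 ^ P.d * ‖φ' x‖ ^ 4) s :=
    ((hasDerivAt_id s).mul_const D.lamRun).mul_const (∑ x ∈ D.Ω₁, P.mesh 0 ^ P.d * ‖φ' x‖ ^ 4)
  have h3 : HasDerivAt (fun u : ℝ => ∑ x ∈ D.Ω₁, P.mesh 0 ^ P.d * D.dm2 e' u x * D.ell ^ 2 * ‖φ' x‖ ^ 2)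
      (∑ x ∈ D.Ω₁, P.mesh 0 ^ P.d * deriv (fun u => D.dm2 e' u x) s * D.ell ^ 2 * ‖φ' x‖ ^ 2) s := by
    refine HasDerivAt.fun_sum (u := D.Ω₁)
      (A := fun x u => P.mesh 0 ^ P.d * D.dm2 e' u x * D.ell ^ 2 * ‖φ' x‖ ^ 2)
      (A' := fun x => P.mesh 0 ^ P.d * deriv (fun u => D.dm2 e' u x) s * D.ell ^ 2 * ‖φ' x‖ ^ 2)
      fun x hx => ?_
    exact (((hdm2d x hx).hasDerivAt.const_mul (P.mesh 0 ^ P.d)).mul_const (D.ell ^ 2)).mul_const (‖φ' x‖ ^ 2)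
  have h4 : HasDerivAt (fun u : ℝ => D.E1 e' u) (deriv (fun u => D.E1 e' u) s) s := hE1d.hasDerivAt
  have h := (h2.add (h3.const_mul (1 / 2 : ℝ))).add h4
  have e : lamExponent D e' φ' = fun u : ℝ => u * D.lamRun * ∑ x ∈ D.Ω₁, P.mesh 0 ^ P.d * ‖φ' x‖ ^ 4
      + (1 / 2 : ℝ) * ∑ x ∈ D.Ω₁, P.mesh 0 ^ P.d * D.dm2 e' u x * D.ell ^ 2 * ‖φ' x‖ ^ 2
      + D.E1 e' u := rfl
  rw [e]
  refine h.congr_deriv ?_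
  rw [lamVertex_def]
  ring

/-- `X′ = V` as functions (data `C^m`, `m ≥ 1`). [cite: Balaban1983Higgs3, (1.4)–(1.7) pp.412–413] -/
theorem iteratedDeriv_one_lamExponent {m : ℕ} {e' : ℝ} (hdm2 : ∀ x ∈ D.Ω₁, ContDiff ℝ m (fun s => D.dm2 e' s x))
    (hE1 : ContDiff ℝ m (fun s => D.E1 e' s)) (hm : 1 ≤ m) (φ' : HiggsLattice.ScalarField P 0 N) :
    iteratedDeriv 1 (lamExponent D e' φ') = fun s => lamVertex D e' s φ' := by
  rw [iteratedDeriv_one]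
  funext s
  exact (hasDerivAt_lamExponent D hdm2 hE1 hm φ' s).deriv

/-- **`X^{(n)} = V_n` for `2 ≤ n ≤ m`** (data `C^m`). [cite: Balaban1983Higgs3, (1.4)–(1.7) pp.412–413] -/
theorem iteratedDeriv_lamExponent_succ_succ {m : ℕ} {e' : ℝ}
    (hdm2 : ∀ x ∈ D.Ω₁, ContDiff ℝ m (fun s => D.dm2 e' s x)) (hE1 : ContDiff ℝ m (fun s => D.E1 e' s))
    (φ' : HiggsLattice.ScalarField P 0 N) :
    ∀ n : ℕ, n + 2 ≤ m → iteratedDeriv (n + 2) (lamExponent D e' φ') = fun s => lamVertexN D (n + 2) e' s φ'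
  | 0, h => by
      rw [iteratedDeriv_succ, iteratedDeriv_one_lamExponent D hdm2 hE1 (by omega) φ']
      funext s
      have hV : HasDerivAt (fun u => lamVertex D e' u φ') (lamVertexN D 2 e' s φ') s := by
        have h1 := (hasDerivAt_const s (D.lamRun * ∑ x ∈ D.Ω₁, P.mesh 0 ^ P.d * ‖φ' x‖ ^ 4)).add
          (hasDerivAt_lamVertexN D hdm2 hE1 (by omega : 1 < m) φ' s)
        have e : (fun u => lamVertex D e' u φ')
            = fun u => D.lamRun * ∑ x ∈ D.Ω₁, P.mesh 0 ^ P.d * ‖φ' x‖ ^ 4 + lamVertexN D 1 e' u φ' :=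
          funext fun u => lamVertex_eq_quartic_add_lamVertexN_one D e' u φ'
        rw [e]
        refine h1.congr_deriv ?_
        rw [zero_add]
      exact hV.deriv
  | n + 1, h => by
      rw [iteratedDeriv_succ, iteratedDeriv_lamExponent_succ_succ hdm2 hE1 φ' n (by omega)]
      funext s
      exact (hasDerivAt_lamVertexN D hdm2 hE1 (by omega : n + 2 < m) φ' s).deriv

/-- **Every `X^{(i)}`, `1 ≤ i ≤ m`, is VERTEX-SHAPED: `|X^{(i)}(s)| ≤ A·exp(tΣ_x|φ′(x)|²)` uniformly on `[0, δ]`**, for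
every `t > 0` (one `A` for all `i ≤ m`; data `C^m`, `λ(L^kε) ≥ 0`). [cite: Balaban1983Higgs3, (1.4)–(1.7) pp.412–413] -/
theorem exists_iteratedDeriv_lamExponent_le (hrun : 0 ≤ D.lamRun) {m : ℕ} {e' δ : ℝ}
    (hdm2 : ∀ x ∈ D.Ω₁, ContDiff ℝ m (fun s => D.dm2 e' s x)) (hE1 : ContDiff ℝ m (fun s => D.E1 e' s))
    {t : ℝ} (ht : 0 < t) :
    ∃ A : ℝ, 0 ≤ A ∧ ∀ i, 1 ≤ i → i ≤ m → ∀ s ∈ Set.Icc (0 : ℝ) δ, ∀ φ' : HiggsLattice.ScalarField P 0 N,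
      |iteratedDeriv i (lamExponent D e' φ') s| ≤ A * Real.exp (t * sqSum φ') := by
  have heach : ∀ i : ℕ, ∃ A : ℝ, 0 ≤ A ∧ (1 ≤ i → i ≤ m → ∀ s ∈ Set.Icc (0 : ℝ) δ,
      ∀ φ' : HiggsLattice.ScalarField P 0 N,
      |iteratedDeriv i (lamExponent D e' φ') s| ≤ A * Real.exp (t * sqSum φ')) := by
    intro i
    by_cases hi : 1 ≤ i ∧ i ≤ m
    · obtain ⟨hi1, him⟩ := hi
      have hm1 : (1 : WithTop ℕ∞) ≤ m := by exact_mod_cast hi1.trans him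
      rcases Nat.lt_or_ge i 2 with hlt | hge
      · have hi_eq : i = 1 := by omega
        subst hi_eq
        obtain ⟨A, hA0, hA⟩ := exists_vertexShape_le D ht hrun (δ := δ)
          (g := fun x s => deriv (fun u => D.dm2 e' u x) s) (h := fun s => deriv (fun u => D.E1 e' u) s)
          (fun x hx => ((hdm2 x hx).continuous_deriv hm1).continuousOn)
          (hE1.continuous_deriv hm1).continuousOn
        refine ⟨A, hA0, fun _ _ s hs φ' => ?_⟩
        rw [iteratedDeriv_one_lamExponent D hdm2 hE1 him φ']
        have h := hA s hs φ'
        rw [← lamVertex_def] at h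
        exact h
      · obtain ⟨n, rfl⟩ : ∃ n, i = n + 2 := ⟨i - 2, by omega⟩
        have hnm : ((n + 2 : ℕ) : WithTop ℕ∞) ≤ m := by exact_mod_cast him
        obtain ⟨A, hA0, hA⟩ := exists_vertexShape_le D ht le_rfl (δ := δ)
          (g := fun x s => iteratedDeriv (n + 2) (fun u => D.dm2 e' u x) s)
          (h := fun s => iteratedDeriv (n + 2) (fun u => D.E1 e' u) s)
          (fun x hx => ((hdm2 x hx).continuous_iteratedDeriv (n + 2) hnm).continuousOn)
          (hE1.continuous_iteratedDeriv (n + 2) hnm).continuousOn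
        refine ⟨A, hA0, fun _ _ s hs φ' => ?_⟩
        rw [iteratedDeriv_lamExponent_succ_succ D hdm2 hE1 φ' n him]
        have h := hA s hs φ'
        rw [zero_mul, zero_add, ← lamVertexN_def] at h
        exact h
    · exact ⟨0, le_rfl, fun h1 h2 => absurd (And.intro h1 h2) hi⟩
  choose A hA0 hA using heach
  refine ⟨∑ i ∈ Finset.range (m + 1), A i, Finset.sum_nonneg fun i _ => hA0 i, fun i hi1 him s hs φ' => ?_⟩
  have hle : A i ≤ ∑ j ∈ Finset.range (m + 1), A j :=
    Finset.single_le_sum (fun j _ => hA0 j) (Finset.mem_range.2 (Nat.lt_succ_of_le him))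
  exact (hA i hi1 him s hs φ').trans (mul_le_mul_of_nonneg_right hle (Real.exp_pos _).le)

/-! ## 2. The Faà di Bruno bound for `∂ⁿ_{λ′}exp[…]` -/

/-- **`|∂ⁿ_{λ′}exp[…](φ′)| ≤ n!·max(1, M)ⁿ·exp[…](φ′)`** whenever `|X^{(i)}(s)| ≤ M` for `1 ≤ i ≤ n` (data `C^n`):
the `n`-th `λ′`-derivative of the density of (1.4) is the density times a polynomial in the vertices
`X′, …, X^{(n)}`, bounded à la Faà di Bruno. [cite: Balaban1983Higgs3, (1.4) p.412] -/
theorem abs_iteratedDeriv_density14_le {n : ℕ} {e' : ℝ} (hdm2 : ∀ x ∈ D.Ω₁, ContDiff ℝ n (fun s => D.dm2 e' s x))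
    (hE1 : ContDiff ℝ n (fun s => D.E1 e' s)) (Ak : HiggsLattice.VecField P 0)
    (A' : (j : Fin k) → HiggsLattice.VecField P j) (φ' : HiggsLattice.ScalarField P 0 N) (s : ℝ) {M : ℝ}
    (hM : ∀ i, 1 ≤ i → i ≤ n → |iteratedDeriv i (lamExponent D e' φ') s| ≤ M) :
    |iteratedDeriv n (fun u => D.density14 Ak e' u A' φ') s|
      ≤ (Nat.factorial n : ℝ) * (max 1 M) ^ n * D.density14 Ak e' s A' φ' := by
  have e : (fun u => D.density14 Ak e' u A' φ')
      = fun u => Real.exp (-(1 / 2 : ℝ) * siteInner φ' (D.scalarOp Ak e' A' φ'))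
          * Real.exp (-lamExponent D e' φ' u) :=
    funext fun u => density14_eq_exp_neg_lamExponent D Ak e' u A' φ'
  rw [e, density14_eq_exp_neg_lamExponent]
  exact abs_iteratedDeriv_const_mul_exp_neg_le (contDiff_lamExponent D hdm2 hE1 φ') (Real.exp_pos _).le s hM

/-! ## 3. The `j`-th `λ′`-derivative integrand `t(Ω;φ,φ′)·∂ʲ_{λ′}exp[…]` -/

/-- The `j`-th `λ′`-DERIVATIVE INTEGRAND of (1.4) on the product of the fluctuation space with the fibre:
`(A′, φ′↾_Ω) ↦ t(Ω; φ, φ′)·∂ʲ_{λ′}exp[…](φ′)|_{λ′=s}` (the kernel carries no `λ′`). (ours)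
[cite: Balaban1983Higgs3, (1.4)–(1.5) p.412] -/
noncomputable def lamIntegrandN (j : ℕ) (e' : ℝ) (Ak : HiggsLattice.VecField P 0) (φ : HiggsLattice.ScalarField P k N)
    (s : ℝ) (z : ((i : Fin k) → HiggsLattice.VecField P i) × (↥D.Ω → EuclideanSpace ℝ (Fin N))) : ℝ :=
  D.kernel14 Ak e' z.1 φ z.2 * iteratedDeriv j (fun u => D.density14 Ak e' u z.1 (extendZero D.Ω z.2)) s

/-- Unfolding of `lamIntegrandN`. [cite: Balaban1983Higgs3, (1.4)–(1.5) p.412] -/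
theorem lamIntegrandN_def (j : ℕ) (e' : ℝ) (Ak : HiggsLattice.VecField P 0) (φ : HiggsLattice.ScalarField P k N)
    (s : ℝ) (z : ((i : Fin k) → HiggsLattice.VecField P i) × (↥D.Ω → EuclideanSpace ℝ (Fin N))) :
    lamIntegrandN D j e' Ak φ s z
      = D.kernel14 Ak e' z.1 φ z.2 * iteratedDeriv j (fun u => D.density14 Ak e' u z.1 (extendZero D.Ω z.2)) s := rfl

/-- `j = 0`: the integrand `t·exp[…]` of (1.4) itself (§9's `integral_integrand14_eq_integral_prod`).
[cite: Balaban1983Higgs3, (1.4) p.412] -/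
theorem lamIntegrandN_zero (e' : ℝ) (Ak : HiggsLattice.VecField P 0) (φ : HiggsLattice.ScalarField P k N)
    (s : ℝ) (z : ((i : Fin k) → HiggsLattice.VecField P i) × (↥D.Ω → EuclideanSpace ℝ (Fin N))) :
    lamIntegrandN D 0 e' Ak φ s z = D.kernel14 Ak e' z.1 φ z.2 * D.density14 Ak e' s z.1 (extendZero D.Ω z.2) := by
  rw [lamIntegrandN_def, iteratedDeriv_zero]

/-- `j = 1`: `−V·t·exp[…]`, the integrand of §7/§9 (data `C^m`, `m ≥ 1`). [cite: Balaban1983Higgs3, (1.4)–(1.5) p.412] -/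
theorem lamIntegrandN_one {m : ℕ} {e' : ℝ} (hdm2 : ∀ x ∈ D.Ω₁, ContDiff ℝ m (fun s => D.dm2 e' s x))
    (hE1 : ContDiff ℝ m (fun s => D.E1 e' s)) (hm : 1 ≤ m) (Ak : HiggsLattice.VecField P 0)
    (φ : HiggsLattice.ScalarField P k N) (s : ℝ)
    (z : ((i : Fin k) → HiggsLattice.VecField P i) × (↥D.Ω → EuclideanSpace ℝ (Fin N))) :
    lamIntegrandN D 1 e' Ak φ s z = -lamVertex D e' s (extendZero D.Ω z.2)
      * (D.kernel14 Ak e' z.1 φ z.2 * D.density14 Ak e' s z.1 (extendZero D.Ω z.2)) := by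
  have hm0 : (m : WithTop ℕ∞) ≠ 0 := by exact_mod_cast Nat.one_le_iff_ne_zero.mp hm
  rw [lamIntegrandN_def, iteratedDeriv_one,
    (hasDerivAt_density14_lam D Ak e' z.1 (extendZero D.Ω z.2) (l := s)
      (fun x hx => ((hdm2 x hx).differentiable hm0).differentiableAt)
      (hE1.differentiable hm0).differentiableAt).deriv]
  ring

/-- `∂²_{λ′}exp[…] = (V² − ∂_{λ′}V)·exp[…]` (data `C^m`, `m ≥ 2`; the integrand of §10 up to the kernel).
[cite: Balaban1983Higgs3, (1.4)–(1.5) p.412] -/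
theorem iteratedDeriv_two_density14 {m : ℕ} {e' : ℝ} (hdm2 : ∀ x ∈ D.Ω₁, ContDiff ℝ m (fun s => D.dm2 e' s x))
    (hE1 : ContDiff ℝ m (fun s => D.E1 e' s)) (hm : 2 ≤ m) (Ak : HiggsLattice.VecField P 0)
    (A' : (j : Fin k) → HiggsLattice.VecField P j) (φ' : HiggsLattice.ScalarField P 0 N) (s : ℝ) :
    iteratedDeriv 2 (fun u => D.density14 Ak e' u A' φ') s
      = (lamVertex D e' s φ' ^ 2 - lamVertex2 D e' s φ') * D.density14 Ak e' s A' φ' := by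
  have hm0 : (m : WithTop ℕ∞) ≠ 0 := by exact_mod_cast (show m ≠ 0 by omega)
  have h2m : (2 : WithTop ℕ∞) ≤ m := by exact_mod_cast hm
  have hdens : ∀ u, HasDerivAt (fun u => D.density14 Ak e' u A' φ')
      (-lamVertex D e' u φ' * D.density14 Ak e' u A' φ') u := fun u =>
    hasDerivAt_density14_lam D Ak e' A' φ' (fun x hx => ((hdm2 x hx).differentiable hm0).differentiableAt)
      (hE1.differentiable hm0).differentiableAt
  have e1 : deriv (fun u => D.density14 Ak e' u A' φ') = fun u => -lamVertex D e' u φ' * D.density14 Ak e' u A' φ' :=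
    funext fun u => (hdens u).deriv
  rw [iteratedDeriv_succ, iteratedDeriv_one, e1]
  have hV := hasDerivAt_lamVertex D e' φ' (l := s) (fun x hx => (hdm2 x hx).of_le h2m) (hE1.of_le h2m)
  have h : HasDerivAt (fun u => -lamVertex D e' u φ' * D.density14 Ak e' u A' φ')
      (-lamVertex2 D e' s φ' * D.density14 Ak e' s A' φ'
        + -lamVertex D e' s φ' * (-lamVertex D e' s φ' * D.density14 Ak e' s A' φ')) s := hV.neg.mul (hdens s)
  rw [h.deriv]
  ring

/-- `j = 2`: `(V² − ∂_{λ′}V)·t·exp[…]` (cf. §10's `hasDerivWithinAt_integral_lamVertex_mul_Icc`, which differentiates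
`∫∫V·t·exp[…] = −∂_{λ′}exp(−E_k)`). [cite: Balaban1983Higgs3, (1.4)–(1.5) p.412] -/
theorem lamIntegrandN_two {m : ℕ} {e' : ℝ} (hdm2 : ∀ x ∈ D.Ω₁, ContDiff ℝ m (fun s => D.dm2 e' s x))
    (hE1 : ContDiff ℝ m (fun s => D.E1 e' s)) (hm : 2 ≤ m) (Ak : HiggsLattice.VecField P 0)
    (φ : HiggsLattice.ScalarField P k N) (s : ℝ)
    (z : ((i : Fin k) → HiggsLattice.VecField P i) × (↥D.Ω → EuclideanSpace ℝ (Fin N))) :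
    lamIntegrandN D 2 e' Ak φ s z
      = (lamVertex D e' s (extendZero D.Ω z.2) ^ 2 - lamVertex2 D e' s (extendZero D.Ω z.2))
        * (D.kernel14 Ak e' z.1 φ z.2 * D.density14 Ak e' s z.1 (extendZero D.Ω z.2)) := by
  rw [lamIntegrandN_def, iteratedDeriv_two_density14 D hdm2 hE1 hm]
  ring

/-- **`∂_{λ′}` of the `j`-th derivative integrand is the `(j+1)`-st**, at every `λ′` (data `C^m`, `j < m`).
[cite: Balaban1983Higgs3, (1.4)–(1.5) p.412] -/
theorem hasDerivAt_lamIntegrandN {m : ℕ} {e' : ℝ} (hdm2 : ∀ x ∈ D.Ω₁, ContDiff ℝ m (fun s => D.dm2 e' s x))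
    (hE1 : ContDiff ℝ m (fun s => D.E1 e' s)) {j : ℕ} (hj : j < m) (Ak : HiggsLattice.VecField P 0)
    (φ : HiggsLattice.ScalarField P k N)
    (z : ((i : Fin k) → HiggsLattice.VecField P i) × (↥D.Ω → EuclideanSpace ℝ (Fin N))) (s : ℝ) :
    HasDerivAt (fun u => lamIntegrandN D j e' Ak φ u z) (lamIntegrandN D (j + 1) e' Ak φ s z) s := by
  have hdens := contDiff_density14_lam D hdm2 hE1 Ak z.1 (extendZero D.Ω z.2)
  have hlt : (j : WithTop ℕ∞) < m := by exact_mod_cast hj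
  have hd : HasDerivAt (iteratedDeriv j (fun u => D.density14 Ak e' u z.1 (extendZero D.Ω z.2)))
      (iteratedDeriv (j + 1) (fun u => D.density14 Ak e' u z.1 (extendZero D.Ω z.2)) s) s := by
    rw [iteratedDeriv_succ]
    exact ((hdens.differentiable_iteratedDeriv j hlt) s).hasDerivAt
  have h := hd.const_mul (D.kernel14 Ak e' z.1 φ z.2)
  simp only [lamIntegrandN_def]
  exact h

/-- The `j`-th derivative integrand is continuous in `λ′` (data `C^m`, `j ≤ m`). [cite: Balaban1983Higgs3, (1.4) p.412] -/
theorem continuous_lamIntegrandN_lam {m : ℕ} {e' : ℝ} (hdm2 : ∀ x ∈ D.Ω₁, ContDiff ℝ m (fun s => D.dm2 e' s x))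
    (hE1 : ContDiff ℝ m (fun s => D.E1 e' s)) {j : ℕ} (hj : j ≤ m) (Ak : HiggsLattice.VecField P 0)
    (φ : HiggsLattice.ScalarField P k N)
    (z : ((i : Fin k) → HiggsLattice.VecField P i) × (↥D.Ω → EuclideanSpace ℝ (Fin N))) :
    Continuous fun u => lamIntegrandN D j e' Ak φ u z := by
  have hdens := contDiff_density14_lam D hdm2 hE1 Ak z.1 (extendZero D.Ω z.2)
  have hle : (j : WithTop ℕ∞) ≤ m := by exact_mod_cast hj
  simp only [lamIntegrandN_def]
  exact continuous_const.mul (hdens.continuous_iteratedDeriv j hle)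

/-- The `j`-th derivative integrand is (strongly) measurable on the product space (data `C^m`, `j ≤ m`).
[cite: Balaban1983Higgs3, (1.4) p.412] -/
theorem aestronglyMeasurable_lamIntegrandN {m : ℕ} {e' : ℝ}
    (hdm2 : ∀ x ∈ D.Ω₁, ContDiff ℝ m (fun s => D.dm2 e' s x)) (hE1 : ContDiff ℝ m (fun s => D.E1 e' s))
    {j : ℕ} (hj : j ≤ m) (Ak : HiggsLattice.VecField P 0) (φ : HiggsLattice.ScalarField P k N) (s : ℝ) :
    AEStronglyMeasurable (lamIntegrandN D j e' Ak φ s) ((fluctFamily P D.msq D.a k).prod volume) := by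
  have h := aestronglyMeasurable_iteratedDeriv_param (ν := (fluctFamily P D.msq D.a k).prod volume)
    (G := fun u (z : ((i : Fin k) → HiggsLattice.VecField P i) × (↥D.Ω → EuclideanSpace ℝ (Fin N))) =>
      D.density14 Ak e' u z.1 (extendZero D.Ω z.2)) (n := m)
    (fun z => contDiff_density14_lam D hdm2 hE1 Ak z.1 (extendZero D.Ω z.2))
    (fun u => (continuous_density14₃ D e' u continuous_const continuous_fst
      ((continuous_extendZero D.Ω).comp continuous_snd)).aestronglyMeasurable) j hj s
  have hker : Continuous fun z : ((i : Fin k) → HiggsLattice.VecField P i) × (↥D.Ω → EuclideanSpace ℝ (Fin N)) =>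
      D.kernel14 Ak e' z.1 φ z.2 :=
    continuous_kernel14₄ D e' continuous_const continuous_fst continuous_const continuous_snd
  have e : lamIntegrandN D j e' Ak φ s = fun z => D.kernel14 Ak e' z.1 φ z.2
      * iteratedDeriv j (fun u => D.density14 Ak e' u z.1 (extendZero D.Ω z.2)) s := rfl
  rw [e]
  exact hker.aestronglyMeasurable.mul h

/-- **ONE INTEGRABLE GAUSSIAN MAJORANT of the `j`-th derivative integrand, uniform in `λ′ ∈ [0, δ]`** (data `C^m`,
`j ≤ m`, hypotheses of §7): `|t·∂ʲ_{λ′}exp[…]| ≤ Cκ·j!(1+A)ʲe^{K₁}·Π_{x∈Ω}exp(−(c/2)|φ′(x)|²)`, `c = m₀(L^kε)²η^d/2`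
(Faà di Bruno with the vertex-shape bound at `t = c/2(j+1)`, `density14_le_explicit`, `kernel14_le`).
[cite: Balaban1983Higgs3, (1.4)–(1.5) p.412] -/
theorem exists_lamIntegrandN_majorant (hmsq : 0 < D.msq) (ha : 0 < D.a) (hL : 1 < (P.L : ℝ))
    (hk1 : 1 ≤ k) (hk : k ≤ P.K) (hℓ : D.ell ≠ 0) (hrun : 0 ≤ D.lamRun) {e' δ m₀ : ℝ} (hm₀ : 0 < m₀)
    (hm₀m : m₀ ≤ D.m2) (hmass : ∀ s ∈ Set.Icc (0 : ℝ) δ, ∀ x ∈ D.Ω₁, m₀ ≤ D.m2 + D.dm2 e' s x)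
    {m : ℕ} (hdm2 : ∀ x ∈ D.Ω₁, ContDiff ℝ m (fun s => D.dm2 e' s x)) (hE1 : ContDiff ℝ m (fun s => D.E1 e' s))
    {j : ℕ} (hj : j ≤ m) (Ak : HiggsLattice.VecField P 0) (φ : HiggsLattice.ScalarField P k N) :
    ∃ bound : ((i : Fin k) → HiggsLattice.VecField P i) × (↥D.Ω → EuclideanSpace ℝ (Fin N)) → ℝ,
      Integrable bound ((fluctFamily P D.msq D.a k).prod volume) ∧
      ∀ s ∈ Set.Icc (0 : ℝ) δ, ∀ z : ((i : Fin k) → HiggsLattice.VecField P i) × (↥D.Ω → EuclideanSpace ℝ (Fin N)),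
        |lamIntegrandN D j e' Ak φ s z| ≤ bound z := by
  haveI := HiggsFluctMeasurePos.fluctFamily_isProbability (P := P) hmsq ha hL hk
  set μ := fluctFamily P D.msq D.a k with hμ
  have hη : 0 < P.mesh 0 ^ P.d := pow_pos (P.mesh_pos 0) _
  have hjm : (j : WithTop ℕ∞) ≤ m := by exact_mod_cast hj
  have hdm2j : ∀ x ∈ D.Ω₁, ContDiff ℝ j (fun s => D.dm2 e' s x) := fun x hx => (hdm2 x hx).of_le hjm
  have hE1j : ContDiff ℝ j (fun s => D.E1 e' s) := hE1.of_le hjm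
  obtain ⟨K₁, hK₁⟩ : ∃ K₁ : ℝ, ∀ s ∈ Set.Icc (0 : ℝ) δ, -D.E1 e' s ≤ K₁ := by
    obtain ⟨C, hC⟩ := isCompact_Icc.exists_bound_of_continuousOn (hE1.continuous.neg.continuousOn (s := Set.Icc 0 δ))
    exact ⟨C, fun s hs => (le_abs_self _).trans ((Real.norm_eq_abs _).symm.le.trans (hC s hs))⟩
  set κ : ℝ := prec (B1.aSeq D.a P.L k) (P.mesh k) P.d with hκdef
  set Cκ : ℝ := ((κ / (2 * Real.pi)) ^ ((Module.finrank ℝ (EuclideanSpace ℝ (Fin N)) : ℝ) / 2))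
      ^ Fintype.card ↥D.Ωk with hCκ
  have hκ0 : 0 ≤ κ := (prec_pos D ha hL hk1).le
  have hCκ0 : 0 ≤ Cκ := pow_nonneg (Real.rpow_nonneg (by positivity) _) _
  set c : ℝ := m₀ * D.ell ^ 2 * P.mesh 0 ^ P.d / 2 with hcdef
  have hℓ2 : 0 < D.ell ^ 2 := by positivity
  have hc : 0 < c := by positivity
  have hj1 : 0 < (j : ℝ) + 1 := by positivity
  set t : ℝ := c / (2 * ((j : ℝ) + 1)) with htdef
  have ht : 0 < t := by positivity
  have hjt : (j : ℝ) * t ≤ c / 2 := by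
    have e1 : (j : ℝ) * t = c / 2 * ((j : ℝ) / ((j : ℝ) + 1)) := by
      rw [htdef]
      field_simp
    rw [e1]
    exact mul_le_of_le_one_right (half_pos hc).le ((div_le_one hj1).2 (by linarith))
  obtain ⟨A, hA0, hA⟩ := exists_iteratedDeriv_lamExponent_le D hrun hdm2j hE1j ht (δ := δ)
  refine ⟨fun z => Cκ * ((Nat.factorial j : ℝ) * (1 + A) ^ j * Real.exp K₁) * ∏ x, Real.exp (-(c / 2) * ‖z.2 x‖ ^ 2),
    (integrable_const _ (μ := μ)).mul_prod (integrable_gauss_fibre D (half_pos hc)), ?_⟩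
  intro s hs z
  have hq : 0 ≤ s * D.lamRun := mul_nonneg hs.1 hrun
  have hkern := kernel14_le D ha.le Ak e' z.1 φ z.2
  have hkern0 := D.kernel14_nonneg ha.le Ak e' z.1 φ z.2
  have hdens := density14_le_explicit D hℓ hm₀ hm₀m (hmass s hs) hq Ak z.1 (extendZero D.Ω z.2)
  have hdens0 := (D.density14_pos Ak e' s z.1 (extendZero D.Ω z.2)).le
  have hM : ∀ i, 1 ≤ i → i ≤ j →
      |iteratedDeriv i (lamExponent D e' (extendZero D.Ω z.2)) s| ≤ A * Real.exp (t * sqSum (extendZero D.Ω z.2)) :=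
    fun i hi1 hij => hA i hi1 hij s hs (extendZero D.Ω z.2)
  have hFdB := abs_iteratedDeriv_density14_le D hdm2j hE1j Ak z.1 (extendZero D.Ω z.2) s hM
  set S : ℝ := sqSum (extendZero D.Ω z.2) with hSdef
  have hS0 : 0 ≤ S := sqSum_nonneg _
  have hS : S = ∑ x, ‖z.2 x‖ ^ 2 := sqSum_extendZero D.Ω z.2
  -- `max(1, A·e^{tS})ʲ ≤ (1 + A)ʲ·e^{jtS}`
  have hex1 : 1 ≤ Real.exp (t * S) := Real.one_le_exp (mul_nonneg ht.le hS0)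
  have hmax : max 1 (A * Real.exp (t * S)) ≤ (1 + A) * Real.exp (t * S) := by
    refine max_le ?_ (mul_le_mul_of_nonneg_right (by linarith) (Real.exp_pos _).le)
    calc (1 : ℝ) = 1 * 1 := (one_mul 1).symm
      _ ≤ (1 + A) * Real.exp (t * S) := mul_le_mul (by linarith) hex1 zero_le_one (by linarith)
  have hmax0 : 0 ≤ max 1 (A * Real.exp (t * S)) := zero_le_one.trans (le_max_left _ _)
  have hpow : (max 1 (A * Real.exp (t * S))) ^ j ≤ (1 + A) ^ j * Real.exp ((j : ℝ) * t * S) := by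
    calc (max 1 (A * Real.exp (t * S))) ^ j ≤ ((1 + A) * Real.exp (t * S)) ^ j := pow_le_pow_left₀ hmax0 hmax j
      _ = (1 + A) ^ j * Real.exp ((j : ℝ) * t * S) := by rw [mul_pow, ← Real.exp_nat_mul, mul_assoc]
  have e3 : -D.E1 e' s - m₀ * D.ell ^ 2 * P.mesh 0 ^ P.d / 2 * S = -D.E1 e' s - c * S := by rw [hcdef]
  rw [e3] at hdens
  have hexpS : Real.exp ((j : ℝ) * t * S) * Real.exp (-D.E1 e' s - c * S) ≤ Real.exp K₁ * Real.exp (-(c / 2) * S) := by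
    rw [← Real.exp_add, ← Real.exp_add, Real.exp_le_exp]
    have h1 := mul_le_mul_of_nonneg_right hjt hS0
    linarith [hK₁ s hs]
  have egauss : Real.exp (-(c / 2) * S) = ∏ x, Real.exp (-(c / 2) * ‖z.2 x‖ ^ 2) := by
    rw [← Real.exp_sum, hS, Finset.mul_sum]
  have hfac0 : 0 ≤ (Nat.factorial j : ℝ) := Nat.cast_nonneg _
  rw [lamIntegrandN_def, abs_mul, abs_of_nonneg hkern0]
  calc D.kernel14 Ak e' z.1 φ z.2 * |iteratedDeriv j (fun u => D.density14 Ak e' u z.1 (extendZero D.Ω z.2)) s|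
      ≤ Cκ * ((Nat.factorial j : ℝ) * (max 1 (A * Real.exp (t * S))) ^ j
          * D.density14 Ak e' s z.1 (extendZero D.Ω z.2)) := mul_le_mul hkern hFdB (abs_nonneg _) hCκ0
    _ ≤ Cκ * ((Nat.factorial j : ℝ) * ((1 + A) ^ j * Real.exp ((j : ℝ) * t * S))
          * Real.exp (-D.E1 e' s - c * S)) := by
        refine mul_le_mul_of_nonneg_left ?_ hCκ0
        exact mul_le_mul (mul_le_mul_of_nonneg_left hpow hfac0) hdens hdens0 (by positivity)
    _ = Cκ * ((Nat.factorial j : ℝ) * (1 + A) ^ j) * (Real.exp ((j : ℝ) * t * S) * Real.exp (-D.E1 e' s - c * S)) := by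
        ring
    _ ≤ Cκ * ((Nat.factorial j : ℝ) * (1 + A) ^ j) * (Real.exp K₁ * Real.exp (-(c / 2) * S)) :=
        mul_le_mul_of_nonneg_left hexpS (by positivity)
    _ = Cκ * ((Nat.factorial j : ℝ) * (1 + A) ^ j * Real.exp K₁) * ∏ x, Real.exp (-(c / 2) * ‖z.2 x‖ ^ 2) := by
        rw [← egauss]; ring

/-- The `j`-th derivative integrand is INTEGRABLE on the product space for every `λ′ ∈ [0, δ]` (data `C^m`, `j ≤ m`).
[cite: Balaban1983Higgs3, (1.4)–(1.5) p.412] -/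
theorem integrable_lamIntegrandN (hmsq : 0 < D.msq) (ha : 0 < D.a) (hL : 1 < (P.L : ℝ))
    (hk1 : 1 ≤ k) (hk : k ≤ P.K) (hℓ : D.ell ≠ 0) (hrun : 0 ≤ D.lamRun) {e' δ m₀ : ℝ} (hm₀ : 0 < m₀)
    (hm₀m : m₀ ≤ D.m2) (hmass : ∀ s ∈ Set.Icc (0 : ℝ) δ, ∀ x ∈ D.Ω₁, m₀ ≤ D.m2 + D.dm2 e' s x)
    {m : ℕ} (hdm2 : ∀ x ∈ D.Ω₁, ContDiff ℝ m (fun s => D.dm2 e' s x)) (hE1 : ContDiff ℝ m (fun s => D.E1 e' s))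
    {j : ℕ} (hj : j ≤ m) (Ak : HiggsLattice.VecField P 0) (φ : HiggsLattice.ScalarField P k N)
    {s : ℝ} (hs : s ∈ Set.Icc (0 : ℝ) δ) :
    Integrable (lamIntegrandN D j e' Ak φ s) ((fluctFamily P D.msq D.a k).prod volume) := by
  obtain ⟨bound, hbound_int, hbound⟩ :=
    exists_lamIntegrandN_majorant D hmsq ha hL hk1 hk hℓ hrun hm₀ hm₀m hmass hdm2 hE1 hj Ak φ
  refine hbound_int.mono' (aestronglyMeasurable_lamIntegrandN D hdm2 hE1 hj Ak φ s)
    (Filter.Eventually.of_forall fun z => ?_)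
  rw [Real.norm_eq_abs]
  exact hbound s hs z

/-- **DIFFERENTIATION UNDER THE INTEGRAL SIGN, `j ↦ j+1`**: on `[0, δ]` the integral of the `j`-th derivative integrand
has derivative the integral of the `(j+1)`-st (data `C^m`, `j < m`; dominated differentiation with the majorant of the
`(j+1)`-st, mean-value majorant on both sides of the base point). [cite: Balaban1983Higgs3, (1.4)–(1.5) p.412] -/
theorem hasDerivWithinAt_integral_lamIntegrandN (hmsq : 0 < D.msq) (ha : 0 < D.a) (hL : 1 < (P.L : ℝ))
    (hk1 : 1 ≤ k) (hk : k ≤ P.K) (hℓ : D.ell ≠ 0) (hrun : 0 ≤ D.lamRun) {e' δ m₀ : ℝ} (hm₀ : 0 < m₀)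
    (hm₀m : m₀ ≤ D.m2) (hmass : ∀ s ∈ Set.Icc (0 : ℝ) δ, ∀ x ∈ D.Ω₁, m₀ ≤ D.m2 + D.dm2 e' s x)
    {m : ℕ} (hdm2 : ∀ x ∈ D.Ω₁, ContDiff ℝ m (fun s => D.dm2 e' s x)) (hE1 : ContDiff ℝ m (fun s => D.E1 e' s))
    {j : ℕ} (hj : j < m) (Ak : HiggsLattice.VecField P 0) (φ : HiggsLattice.ScalarField P k N)
    {s₀ : ℝ} (hs₀ : s₀ ∈ Set.Icc (0 : ℝ) δ) :
    HasDerivWithinAt (fun s => ∫ z, lamIntegrandN D j e' Ak φ s z ∂((fluctFamily P D.msq D.a k).prod volume))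
      (∫ z, lamIntegrandN D (j + 1) e' Ak φ s₀ z ∂((fluctFamily P D.msq D.a k).prod volume)) (Set.Icc 0 δ) s₀ := by
  obtain ⟨bound, hbound_int, hbound⟩ :=
    exists_lamIntegrandN_majorant D hmsq ha hL hk1 hk hℓ hrun hm₀ hm₀m hmass hdm2 hE1 (Nat.succ_le_of_lt hj) Ak φ
  exact hasDerivWithinAt_integral_Icc_dominated hs₀
    (fun s => aestronglyMeasurable_lamIntegrandN D hdm2 hE1 hj.le Ak φ s)
    (fun s hs => integrable_lamIntegrandN D hmsq ha hL hk1 hk hℓ hrun hm₀ hm₀m hmass hdm2 hE1 hj.le Ak φ hs)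
    (fun z s => hasDerivAt_lamIntegrandN D hdm2 hE1 hj Ak φ z s) hbound hbound_int

/-- The integral of the `j`-th derivative integrand is CONTINUOUS on `[0, δ]` (data `C^m`, `j ≤ m`; dominated
convergence). [cite: Balaban1983Higgs3, (1.4)–(1.5) p.412] -/
theorem continuousOn_integral_lamIntegrandN (hmsq : 0 < D.msq) (ha : 0 < D.a) (hL : 1 < (P.L : ℝ))
    (hk1 : 1 ≤ k) (hk : k ≤ P.K) (hℓ : D.ell ≠ 0) (hrun : 0 ≤ D.lamRun) {e' δ m₀ : ℝ} (hm₀ : 0 < m₀)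
    (hm₀m : m₀ ≤ D.m2) (hmass : ∀ s ∈ Set.Icc (0 : ℝ) δ, ∀ x ∈ D.Ω₁, m₀ ≤ D.m2 + D.dm2 e' s x)
    {m : ℕ} (hdm2 : ∀ x ∈ D.Ω₁, ContDiff ℝ m (fun s => D.dm2 e' s x)) (hE1 : ContDiff ℝ m (fun s => D.E1 e' s))
    {j : ℕ} (hj : j ≤ m) (Ak : HiggsLattice.VecField P 0) (φ : HiggsLattice.ScalarField P k N) :
    ContinuousOn (fun s => ∫ z, lamIntegrandN D j e' Ak φ s z ∂((fluctFamily P D.msq D.a k).prod volume))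
      (Set.Icc 0 δ) := by
  obtain ⟨bound, hbound_int, hbound⟩ :=
    exists_lamIntegrandN_majorant D hmsq ha hL hk1 hk hℓ hrun hm₀ hm₀m hmass hdm2 hE1 hj Ak φ
  refine MeasureTheory.continuousOn_of_dominated (bound := bound)
    (fun s _ => aestronglyMeasurable_lamIntegrandN D hdm2 hE1 hj Ak φ s)
    (fun s hs => Filter.Eventually.of_forall fun z => ?_) hbound_int
    (Filter.Eventually.of_forall fun z => (continuous_lamIntegrandN_lam D hdm2 hE1 hj Ak φ z).continuousOn)
  rw [Real.norm_eq_abs]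
  exact hbound s hs z

/-! ## 4. `exp(−E_k)` and `E_k` are `C^n` in `λ′` on `[0, δ]` -/

/-- **THE `j`-TH `λ′`-DERIVATIVE OF `exp(−E_k)` ON `[0, δ]` IS THE INTEGRAL OF THE `j`-TH DERIVATIVE INTEGRAND**:
`iteratedDerivWithin j (λ′ ↦ Π_i∫dμ(A′_i) T[Ω, exp[…]](φ)) [0,δ] λ′ = ∫∫ t·∂ʲ_{λ′}exp[…] d(μ ⊗ dφ′↾_Ω)` for every
`j ≤ m` and `λ′ ∈ [0, δ]` (data `C^m`, hypotheses of §7) — differentiation under the integral sign to all orders.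
[cite: Balaban1983Higgs3, (1.4)–(1.5) p.412] -/
theorem iteratedDerivWithin_integral_integrand14_lam (hmsq : 0 < D.msq) (ha : 0 < D.a) (hL : 1 < (P.L : ℝ))
    (hk1 : 1 ≤ k) (hk : k ≤ P.K) (hℓ : D.ell ≠ 0) (hrun : 0 ≤ D.lamRun) {e' δ m₀ : ℝ} (hδ : 0 < δ) (hm₀ : 0 < m₀)
    (hm₀m : m₀ ≤ D.m2) (hmass : ∀ s ∈ Set.Icc (0 : ℝ) δ, ∀ x ∈ D.Ω₁, m₀ ≤ D.m2 + D.dm2 e' s x)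
    {m : ℕ} (hdm2 : ∀ x ∈ D.Ω₁, ContDiff ℝ m (fun s => D.dm2 e' s x)) (hE1 : ContDiff ℝ m (fun s => D.E1 e' s))
    (Ak : HiggsLattice.VecField P 0) (φ : HiggsLattice.ScalarField P k N) :
    ∀ j, j ≤ m → ∀ s ∈ Set.Icc (0 : ℝ) δ,
      iteratedDerivWithin j (fun s => ∫ A', D.integrand14 e' s Ak φ A' ∂(fluctFamily P D.msq D.a k)) (Set.Icc 0 δ) s
        = ∫ z, lamIntegrandN D j e' Ak φ s z ∂((fluctFamily P D.msq D.a k).prod volume) := by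
  have hm2 : 0 < D.m2 := lt_of_lt_of_le hm₀ hm₀m
  intro j
  induction j with
  | zero =>
    intro _ s hs
    rw [iteratedDerivWithin_zero]
    have hreg : 0 < s * D.lamRun ∨ ∀ x ∈ D.Ω₁, 0 < D.m2 + D.dm2 e' s x :=
      Or.inr fun x hx => lt_of_lt_of_le hm₀ (hmass s hs x hx)
    rw [(integral_integrand14_eq_integral_prod D hmsq ha hL hk hm2 hℓ (mul_nonneg hs.1 hrun) hreg Ak φ).2]
    refine integral_congr_ae (Filter.Eventually.of_forall fun z => ?_)
    exact (lamIntegrandN_zero D e' Ak φ s z).symm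
  | succ j ih =>
    intro hj s hs
    have hjm : j < m := Nat.lt_of_succ_le hj
    rw [iteratedDerivWithin_succ, derivWithin_congr (fun u hu => ih hjm.le u hu) (ih hjm.le s hs)]
    exact (hasDerivWithinAt_integral_lamIntegrandN D hmsq ha hL hk1 hk hℓ hrun hm₀ hm₀m hmass hdm2 hE1 hjm Ak φ
      hs).derivWithin (uniqueDiffOn_Icc hδ s hs)

/-- **`λ′ ↦ exp(−E_k(e′,λ′,Ω,A^{(k)},φ))` IS `C^m` ON `[0, δ]` FOR `C^m` DATA** (hypotheses of §7).
[cite: Balaban1983Higgs3, (1.4)–(1.5) p.412] -/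
theorem contDiffOn_integral_integrand14_lam (hmsq : 0 < D.msq) (ha : 0 < D.a) (hL : 1 < (P.L : ℝ))
    (hk1 : 1 ≤ k) (hk : k ≤ P.K) (hℓ : D.ell ≠ 0) (hrun : 0 ≤ D.lamRun) {e' δ m₀ : ℝ} (hδ : 0 < δ) (hm₀ : 0 < m₀)
    (hm₀m : m₀ ≤ D.m2) (hmass : ∀ s ∈ Set.Icc (0 : ℝ) δ, ∀ x ∈ D.Ω₁, m₀ ≤ D.m2 + D.dm2 e' s x)
    {m : ℕ} (hdm2 : ∀ x ∈ D.Ω₁, ContDiff ℝ m (fun s => D.dm2 e' s x)) (hE1 : ContDiff ℝ m (fun s => D.E1 e' s))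
    (Ak : HiggsLattice.VecField P 0) (φ : HiggsLattice.ScalarField P k N) :
    ContDiffOn ℝ m (fun s => ∫ A', D.integrand14 e' s Ak φ A' ∂(fluctFamily P D.msq D.a k)) (Set.Icc 0 δ) := by
  have hI := iteratedDerivWithin_integral_integrand14_lam D hmsq ha hL hk1 hk hℓ hrun hδ hm₀ hm₀m hmass hdm2 hE1 Ak φ
  refine (contDiffOn_nat_iff_continuousOn_differentiableOn_deriv (uniqueDiffOn_Icc hδ)).2 ⟨fun j hj => ?_, fun j hj => ?_⟩
  · exact (continuousOn_integral_lamIntegrandN D hmsq ha hL hk1 hk hℓ hrun hm₀ hm₀m hmass hdm2 hE1 hj Ak φ).congr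
      fun s hs => hI j hj s hs
  · intro s hs
    exact (hasDerivWithinAt_integral_lamIntegrandN D hmsq ha hL hk1 hk hℓ hrun hm₀ hm₀m hmass hdm2 hE1 hj Ak φ
      hs).differentiableWithinAt.congr (fun u hu => hI j hj.le u hu) (hI j hj.le s hs)

/-- **`λ′ ↦ E_k(e′,λ′,Ω,A^{(k)},φ)` IS `C^m` ON `[0, δ]` FOR `C^m` DATA** (`E_k = −log` of a positive `C^m`
function): ALL the one-sided `λ′`-derivatives that the `β`-sum of the repaired (1.5) names exist, up to the
regularity of the supplied counterterm data. [cite: Balaban1983Higgs3, (1.4)–(1.5) p.412] -/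
theorem contDiffOn_auxE_lam (hmsq : 0 < D.msq) (ha : 0 < D.a) (hL : 1 < (P.L : ℝ))
    (hk1 : 1 ≤ k) (hk : k ≤ P.K) (hℓ : D.ell ≠ 0) (hrun : 0 ≤ D.lamRun) {e' δ m₀ : ℝ} (hδ : 0 < δ) (hm₀ : 0 < m₀)
    (hm₀m : m₀ ≤ D.m2) (hmass : ∀ s ∈ Set.Icc (0 : ℝ) δ, ∀ x ∈ D.Ω₁, m₀ ≤ D.m2 + D.dm2 e' s x)
    {m : ℕ} (hdm2 : ∀ x ∈ D.Ω₁, ContDiff ℝ m (fun s => D.dm2 e' s x)) (hE1 : ContDiff ℝ m (fun s => D.E1 e' s))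
    (Ak : HiggsLattice.VecField P 0) (φ : HiggsLattice.ScalarField P k N) :
    ContDiffOn ℝ m (fun s => D.auxE e' s Ak φ) (Set.Icc 0 δ) := by
  have hm2 : 0 < D.m2 := lt_of_lt_of_le hm₀ hm₀m
  have hZ := contDiffOn_integral_integrand14_lam D hmsq ha hL hk1 hk hℓ hrun hδ hm₀ hm₀m hmass hdm2 hE1 Ak φ
  have hpos : ∀ s ∈ Set.Icc (0 : ℝ) δ, (∫ A', D.integrand14 e' s Ak φ A' ∂(fluctFamily P D.msq D.a k)) ≠ 0 :=
    fun s hs => (integral_integrand14_pos D hmsq ha hL hk1 hk hm2 hℓ (mul_nonneg hs.1 hrun)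
      (Or.inr fun x hx => lt_of_lt_of_le hm₀ (hmass s hs x hx)) Ak φ).ne'
  have h := (hZ.log hpos).neg
  have e : (fun s => D.auxE e' s Ak φ)
      = fun s => -Real.log (∫ A', D.integrand14 e' s Ak φ A' ∂(fluctFamily P D.msq D.a k)) := rfl
  rw [e]
  exact h

/-- On `[0, δ]` each `λ′`-derivative of `E_k` is the derivative (within `[0, δ]`) of the previous one (data `C^m`,
`j < m`). [cite: Balaban1983Higgs3, (1.4)–(1.5) p.412] -/
theorem hasDerivWithinAt_iteratedDerivWithin_auxE_Icc (hmsq : 0 < D.msq) (ha : 0 < D.a) (hL : 1 < (P.L : ℝ))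
    (hk1 : 1 ≤ k) (hk : k ≤ P.K) (hℓ : D.ell ≠ 0) (hrun : 0 ≤ D.lamRun) {e' δ m₀ : ℝ} (hδ : 0 < δ) (hm₀ : 0 < m₀)
    (hm₀m : m₀ ≤ D.m2) (hmass : ∀ s ∈ Set.Icc (0 : ℝ) δ, ∀ x ∈ D.Ω₁, m₀ ≤ D.m2 + D.dm2 e' s x)
    {m : ℕ} (hdm2 : ∀ x ∈ D.Ω₁, ContDiff ℝ m (fun s => D.dm2 e' s x)) (hE1 : ContDiff ℝ m (fun s => D.E1 e' s))
    (Ak : HiggsLattice.VecField P 0) (φ : HiggsLattice.ScalarField P k N) {j : ℕ} (hj : j < m)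
    {s : ℝ} (hs : s ∈ Set.Icc (0 : ℝ) δ) :
    HasDerivWithinAt (iteratedDerivWithin j (fun u => D.auxE e' u Ak φ) (Set.Icc 0 δ))
      (iteratedDerivWithin (j + 1) (fun u => D.auxE e' u Ak φ) (Set.Icc 0 δ) s) (Set.Icc 0 δ) s := by
  have hE := contDiffOn_auxE_lam D hmsq ha hL hk1 hk hℓ hrun hδ hm₀ hm₀m hmass hdm2 hE1 Ak φ
  have hlt : (j : WithTop ℕ∞) < m := by exact_mod_cast hj
  rw [iteratedDerivWithin_succ]
  exact ((hE.differentiableOn_iteratedDerivWithin hlt (uniqueDiffOn_Icc hδ)) s hs).hasDerivWithinAt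

/-- The quantities `iteratedDerivWithin β (λ′ ↦ E_k) [0,∞) 0` of the repaired (1.5)
(`B3Eq15OneSidedInteraction.interaction15R`, `B3Sect1Counterterms.pert15R`) are the derivatives within `[0, δ]`
at `0`. [cite: Balaban1983Higgs3, (1.5) p.412] -/
theorem iteratedDerivWithin_auxE_Ici_eq_Icc {δ : ℝ} (hδ : 0 < δ) (e' : ℝ) (Ak : HiggsLattice.VecField P 0)
    (φ : HiggsLattice.ScalarField P k N) (β : ℕ) :
    iteratedDerivWithin β (fun u => D.auxE e' u Ak φ) (Set.Ici 0) 0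
      = iteratedDerivWithin β (fun u => D.auxE e' u Ak φ) (Set.Icc 0 δ) 0 :=
  iteratedDerivWithin_Ici_eq_Icc hδ β

/-- **EVERY `β`-TERM OF THE REPAIRED (1.5) IS A GENUINE RIGHT DERIVATIVE AT `0⁺` OF THE PREVIOUS ONE**: for data of
class `C^m` and `β < m`, `λ′ ↦ iteratedDerivWithin β (E_k(e′,·)) [0,∞)` has, within `[0,∞)` at `0`, the derivative
`iteratedDerivWithin (β+1) (E_k(e′,·)) [0,∞) 0` — the number entering `interaction15R`/`pert15R` with weight
`1/(α!(β+1)!)`. (ours; hypotheses of §7) [cite: Balaban1983Higgs3, (1.5) p.412] -/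
theorem hasDerivWithinAt_iteratedDerivWithin_auxE_Ici (hmsq : 0 < D.msq) (ha : 0 < D.a) (hL : 1 < (P.L : ℝ))
    (hk1 : 1 ≤ k) (hk : k ≤ P.K) (hℓ : D.ell ≠ 0) (hrun : 0 ≤ D.lamRun) {e' δ m₀ : ℝ} (hδ : 0 < δ) (hm₀ : 0 < m₀)
    (hm₀m : m₀ ≤ D.m2) (hmass : ∀ s ∈ Set.Icc (0 : ℝ) δ, ∀ x ∈ D.Ω₁, m₀ ≤ D.m2 + D.dm2 e' s x)
    {m : ℕ} (hdm2 : ∀ x ∈ D.Ω₁, ContDiff ℝ m (fun s => D.dm2 e' s x)) (hE1 : ContDiff ℝ m (fun s => D.E1 e' s))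
    (Ak : HiggsLattice.VecField P 0) (φ : HiggsLattice.ScalarField P k N) {β : ℕ} (hβ : β < m) :
    HasDerivWithinAt (iteratedDerivWithin β (fun u => D.auxE e' u Ak φ) (Set.Ici 0))
      (iteratedDerivWithin (β + 1) (fun u => D.auxE e' u Ak φ) (Set.Ici 0) 0) (Set.Ici 0) 0 := by
  have h0 : (0 : ℝ) ∈ Set.Icc (0 : ℝ) δ := ⟨le_rfl, hδ.le⟩
  have h := hasDerivWithinAt_iteratedDerivWithin_auxE_Icc D hmsq ha hL hk1 hk hℓ hrun hδ hm₀ hm₀m hmass hdm2 hE1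
    Ak φ hβ h0
  rw [iteratedDerivWithin_auxE_Ici_eq_Icc D hδ]
  have hIco : Set.Ico (0 : ℝ) δ ∈ 𝓝[Set.Icc 0 δ] (0 : ℝ) := by
    rw [mem_nhdsWithin]
    exact ⟨Set.Iio δ, isOpen_Iio, hδ, fun x hx => ⟨hx.2.1, hx.1⟩⟩
  have hcongr : iteratedDerivWithin β (fun u => D.auxE e' u Ak φ) (Set.Ici 0)
      =ᶠ[𝓝[Set.Icc 0 δ] (0 : ℝ)] iteratedDerivWithin β (fun u => D.auxE e' u Ak φ) (Set.Icc 0 δ) := by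
    filter_upwards [hIco] with u hu using iteratedDerivWithin_Ici_eq_Icc hu.2 β
  have h' := h.congr_of_eventuallyEq hcongr (iteratedDerivWithin_Ici_eq_Icc hδ β)
  exact h'.mono_of_mem_nhdsWithin (Icc_mem_nhdsGE hδ)

/-! ## 5. Taylor's formula: the `λ′`-column of (1.5) with remainder -/

/-- **TAYLOR'S FORMULA FOR `E_k(e′, ·)` AT `λ′ = 0⁺` WITH AN `O(λ′^{n+1})` REMAINDER**: for data of class `C^{n+1}`
(hypotheses of §7) there is `C` with
`|E_k(e′,λ′) − Σ_{β=0}^{n} (β!)⁻¹ λ′^β · iteratedDerivWithin β (E_k(e′,·)) [0,∞) 0| ≤ C·λ′^{n+1}` for all `λ′ ∈ [0, δ]`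
— the `β`-terms of the repaired (1.5) (its `α = 0` column, read at the expansion parameter `λ′`; the print sets the
parameter to `1`, paper I (3.36)/(3.62)) ARE the Taylor coefficients of the typed `E_k` in `λ′`, and the expansion
they form approximates `E_k` to the printed order (Mathlib's `exists_taylor_mean_remainder_bound`). (ours)
[cite: Balaban1983Higgs3, (1.5) p.412] -/
theorem exists_auxE_taylor_remainder_le (hmsq : 0 < D.msq) (ha : 0 < D.a) (hL : 1 < (P.L : ℝ))
    (hk1 : 1 ≤ k) (hk : k ≤ P.K) (hℓ : D.ell ≠ 0) (hrun : 0 ≤ D.lamRun) {e' δ m₀ : ℝ} (hδ : 0 < δ) (hm₀ : 0 < m₀)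
    (hm₀m : m₀ ≤ D.m2) (hmass : ∀ s ∈ Set.Icc (0 : ℝ) δ, ∀ x ∈ D.Ω₁, m₀ ≤ D.m2 + D.dm2 e' s x)
    {n : ℕ} (hdm2 : ∀ x ∈ D.Ω₁, ContDiff ℝ (n + 1) (fun s => D.dm2 e' s x))
    (hE1 : ContDiff ℝ (n + 1) (fun s => D.E1 e' s))
    (Ak : HiggsLattice.VecField P 0) (φ : HiggsLattice.ScalarField P k N) :
    ∃ C : ℝ, ∀ s ∈ Set.Icc (0 : ℝ) δ,
      |D.auxE e' s Ak φ - ∑ β ∈ Finset.range (n + 1),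
          (Nat.factorial β : ℝ)⁻¹ * s ^ β * iteratedDerivWithin β (fun u => D.auxE e' u Ak φ) (Set.Ici 0) 0|
        ≤ C * s ^ (n + 1) := by
  have hdm2' : ∀ x ∈ D.Ω₁, ContDiff ℝ ((n + 1 : ℕ) : WithTop ℕ∞) (fun s => D.dm2 e' s x) := fun x hx => by
    exact_mod_cast hdm2 x hx
  have hE1' : ContDiff ℝ ((n + 1 : ℕ) : WithTop ℕ∞) (fun s => D.E1 e' s) := by exact_mod_cast hE1
  have hE : ContDiffOn ℝ (n + 1) (fun u => D.auxE e' u Ak φ) (Set.Icc 0 δ) := by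
    have h := contDiffOn_auxE_lam D hmsq ha hL hk1 hk hℓ hrun hδ hm₀ hm₀m hmass hdm2' hE1' Ak φ
    exact_mod_cast h
  obtain ⟨C, hC⟩ := exists_taylor_mean_remainder_bound (f := fun u => D.auxE e' u Ak φ) (n := n) hδ.le hE
  refine ⟨C, fun s hs => ?_⟩
  have h := hC s hs
  rw [taylor_within_apply, Real.norm_eq_abs, sub_zero] at h
  have e : ∑ β ∈ Finset.range (n + 1),
      ((Nat.factorial β : ℝ)⁻¹ * s ^ β) • iteratedDerivWithin β (fun u => D.auxE e' u Ak φ) (Set.Icc 0 δ) 0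
      = ∑ β ∈ Finset.range (n + 1),
        (Nat.factorial β : ℝ)⁻¹ * s ^ β * iteratedDerivWithin β (fun u => D.auxE e' u Ak φ) (Set.Ici 0) 0 := by
    refine Finset.sum_congr rfl fun β _ => ?_
    rw [smul_eq_mul, iteratedDerivWithin_auxE_Ici_eq_Icc D hδ]
  rw [e] at h
  exact h

end LamAllOrders

end

end Literature.MathematicalPhysics.QuantumFieldTheory.Balaban1983to89.B3Eq14LamAllOrders
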